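import Literature.NumberTheory.Sieve.HardyLittlewoodChowlaFourier
import Literature.NumberTheory.Sieve.HardyLittlewoodChowlaSieve
import Literature.NumberTheory.Sieve.HardyLittlewoodChowlaSingular
import Literature.NumberTheory.Sieve.HardyLittlewoodChowlaMoebius
import HarnessLib

/-!
# Hardy–Littlewood–Chowla on average (Lichtman–Teräväinen 2022): §4, the assembly of Theorem 1.2 (i)

Topic `Literature/NumberTheory/Sieve`, companion of `HardyLittlewoodChowla.lean` (the named facts
`lichtmanTeravainen2022_hlc_avg`, `lichtmanTeravainen2022_hlc_avg_liouville` = J. D. Lichtman,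
J. Teräväinen, *On the Hardy–Littlewood–Chowla conjecture on average*, Forum Math. Sigma 10 (2022)
e57, doi:10.1017/fms.2022.54, arXiv:2111.08912 [LichtmanTeravainen2022], Theorem 1.2 (i)) and of
`HardyLittlewoodChowlaFourier.lean` (Prop. 3.2), `HardyLittlewoodChowlaSieve.lean` (Lemmas 2.3,
2.4, 2.11), `HardyLittlewoodChowlaSingular.lean` (Lemma 2.5), `HardyLittlewoodChowlaMoebius.lean`
(Prop. 2.1 for `μ`, the typical set).  Everything in this file is PROVED; it introduces no
definition and no named fact.

This file is **§4 of the paper** ("Proofs of the main theorems", held copy `paper:arxiv-2111.08912`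
pp. 11–12): the deduction of Theorem 1.6 / Theorem 1.2 (i) from Proposition 2.1 (the `𝖧₂` input),
Proposition 2.7 (the `𝖧₁` input), Proposition 3.2 (the Fourier argument) and Lemmas 2.3, 2.5, 2.11
(the exceptional set `n + h ∉ 𝒮` and `E_g ≍ 1`), carried out for a real `1`-bounded `f` in place of
`μ` and with Proposition 2.7 entering as an explicit hypothesis `hM` (in exactly the form of
hypothesis `hA₁` of `LichtmanTeravainen2022.holder_fourier_bound`, any power of `log log X` being
allowed in its constant):

* `hlc_avg_core` — the generic deduction: for `(log X)^{#A+ε} ≤ H ≤ exp((log X)^a)`,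
  `∑_{h ≤ H} |∑_{n ≤ X} ∏_{a∈A} Λ(n+a) ∏_{b∈{h}∪B'} f(n+b)| ≤ C H X log log H/log H`, with
  `a = 1/(625(2j + C₀))` (`2j` the moment exponent, `C₀` the power of `log log X` in `hM`);
* `hlc_avg_moebius_of_moments`, `hlc_avg_liouville_of_moments` — the two named facts with
  `hlcMoebiusSum` / `hlcLiouvilleSum` unfolded, conditional only on `hM`
  (`moebius_typ_window_sq_le` of `HardyLittlewoodChowlaMoebius.lean`, resp.
  `liouville_typ_window_sq_le` below, supplying `𝖧₂`);
* the pieces of §4: `hlc_params` (the regime `V = (log H)^{2j+C₀}`, `W = V⁵`, `P₁ = W^{200}`,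
  `Q₁ = 2H/W³` and all the inequalities between `X, H, V` used), `pq_facts`
  (`log P₁/log Q₁ ≪ log log H/log H`), `exceptional_sum_le` (displays (4.1)–(4.2): Lemma 2.11 then
  Lemma 2.5), `main_sum_le` + `main_term_algebra` (display (4.4): Proposition 3.2 with
  `A₂ = C (2H)² X₃/V`, `A₁ = B (log log X)^{C₀} (2H)^{2j−1} X₃`, giving `≪ H X₃/log H`),
  `sum_prod_vonMangoldt_le_linear` (`E_g ≍ 1`, for the `O(1)` shifts `h ∈ A ∪ B'`),
  `sum_prod_weight_le` (Lemma 2.5 for `∏_{a∈A} |h−a|/φ(|h−a|)`).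

With a proof `hM` of Proposition 2.7 (e.g. from `HardyLittlewoodChowlaMomentsPrep.lean` and
`HardyLittlewoodChowlaTuples.lean`), `lichtmanTeravainen2022_hlc_avg_holds` is
`hlc_avg_moebius_of_moments hM` (and likewise for `λ`).

## References

* J. D. Lichtman, J. Teräväinen, Forum Math. Sigma 10 (2022) e57, arXiv:2111.08912, §4 (proof of
  Theorem 1.6, displays (4.1)–(4.5)), Remark 1.7, Proposition 2.1.
  [cite: LichtmanTeravainen2022, Section 4, proof of Theorem 1.6]
* K. Matomäki, M. Radziwiłł, T. Tao, Algebra Number Theory 9 (2015) 2167–2196, Theorem 2.3 and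
  (1.12). [cite: MatomakiRadziwillTao2015, Theorem 2.3 and (1.12)]
-/

noncomputable section

open Finset Real MeasureTheory
open scoped FourierTransform Classical ArithmeticFunction.vonMangoldt

namespace Literature.NumberTheory.Sieve

namespace LichtmanTeravainen2022

open Literature.NumberTheory.LFunctions
open Literature.NumberTheory.LFunctions.MRT2015

/-- `(log H)^k ≤ H` for `H ≥ H₀(k)` (real `H`). [folklore] -/
theorem exists_pow_log_le_self (k : ℕ) : ∃ H₀ : ℝ, ∀ H : ℝ, H₀ ≤ H → Real.log H ^ k ≤ H := by
  rcases Nat.eq_zero_or_pos k with rfl | hk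
  · exact ⟨1, fun H hH => by simpa using hH⟩
  refine ⟨max 1 ((2 * k : ℝ) ^ (2 * k)), fun H hH => ?_⟩
  have hH1 : 1 ≤ H := le_trans (le_max_left _ _) hH
  have hH0 : 0 < H := by linarith
  have hk0 : (0 : ℝ) < k := by exact_mod_cast hk
  set ε : ℝ := 1 / (2 * k) with hε
  have hε0 : 0 < ε := by rw [hε]; positivity
  have hlog0 : 0 ≤ Real.log H := Real.log_nonneg hH1
  have h1 : Real.log H ≤ H ^ ε / ε := Real.log_le_rpow_div hH0.le hε0
  have h2 : Real.log H ^ k ≤ (H ^ ε / ε) ^ k := pow_le_pow_left₀ hlog0 h1 k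
  have h3 : (H ^ ε / ε) ^ k = (2 * k : ℝ) ^ k * H ^ (1 / 2 : ℝ) := by
    rw [div_pow, ← Real.rpow_natCast (H ^ ε) k, ← Real.rpow_mul hH0.le, hε]
    have : 1 / (2 * (k : ℝ)) * (k : ℝ) = 1 / 2 := by field_simp
    rw [this]
    have : (1 / (2 * (k : ℝ))) ^ k = ((2 * k : ℝ) ^ k)⁻¹ := by rw [one_div, inv_pow]
    rw [this]
    field_simp
  rw [h3] at h2
  refine h2.trans ?_
  -- `(2k)^k √H ≤ H` iff `(2k)^k ≤ √H`
  have hsq : H ^ (1 / 2 : ℝ) * H ^ (1 / 2 : ℝ) = H := by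
    rw [← Real.rpow_add hH0]; norm_num
  have hroot : (2 * k : ℝ) ^ k ≤ H ^ (1 / 2 : ℝ) := by
    have h4 : ((2 * k : ℝ) ^ (2 * k)) ^ (1 / 2 : ℝ) ≤ H ^ (1 / 2 : ℝ) :=
      Real.rpow_le_rpow (by positivity) (le_trans (le_max_right _ _) hH) (by norm_num)
    have h5 : ((2 * k : ℝ) ^ (2 * k)) ^ (1 / 2 : ℝ) = (2 * k : ℝ) ^ k := by
      rw [← Real.rpow_natCast ((2 * k : ℝ)) (2 * k), ← Real.rpow_mul (by positivity)]
      push_cast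
      have : 2 * (k : ℝ) * (1 / 2) = k := by ring
      rw [this, Real.rpow_natCast]
    rwa [h5] at h4
  calc (2 * k : ℝ) ^ k * H ^ (1 / 2 : ℝ) ≤ H ^ (1 / 2 : ℝ) * H ^ (1 / 2 : ℝ) :=
        mul_le_mul_of_nonneg_right hroot (Real.rpow_nonneg hH0.le _)
    _ = H := hsq

/-- `c · log s ≤ s` for `s ≥ s₀(c)`. [folklore] -/
theorem exists_mul_log_le_self (c : ℝ) : ∃ s₀ : ℝ, 1 ≤ s₀ ∧ ∀ s : ℝ, s₀ ≤ s → c * Real.log s ≤ s := by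
  rcases le_or_gt c 0 with hc | hc
  · refine ⟨1, le_rfl, fun s hs => ?_⟩
    have : 0 ≤ Real.log s := Real.log_nonneg hs
    nlinarith
  · refine ⟨max 1 ((2 * c) ^ 2), le_max_left _ _, fun s hs => ?_⟩
    have hs1 : 1 ≤ s := le_trans (le_max_left _ _) hs
    have hs0 : 0 < s := by linarith
    have h1 : Real.log s ≤ s ^ (1 / 2 : ℝ) / (1 / 2) := Real.log_le_rpow_div hs0.le (by norm_num)
    have hsq : s ^ (1 / 2 : ℝ) * s ^ (1 / 2 : ℝ) = s := by
      rw [← Real.rpow_add hs0]; norm_num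
    have hroot : 2 * c ≤ s ^ (1 / 2 : ℝ) := by
      have h4 : ((2 * c) ^ 2) ^ (1 / 2 : ℝ) ≤ s ^ (1 / 2 : ℝ) :=
        Real.rpow_le_rpow (by positivity) (le_trans (le_max_right _ _) hs) (by norm_num)
      have h5 : ((2 * c) ^ 2) ^ (1 / 2 : ℝ) = 2 * c := by
        rw [← Real.sqrt_eq_rpow, Real.sqrt_sq (by linarith)]
      rwa [h5] at h4
    calc c * Real.log s ≤ c * (s ^ (1 / 2 : ℝ) / (1 / 2)) := mul_le_mul_of_nonneg_left h1 hc.le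
      _ = (2 * c) * s ^ (1 / 2 : ℝ) := by ring
      _ ≤ s ^ (1 / 2 : ℝ) * s ^ (1 / 2 : ℝ) :=
          mul_le_mul_of_nonneg_right hroot (Real.rpow_nonneg hs0.le _)
      _ = s := hsq

/-- Root extraction: `y^m ≤ c z^m` with `y, z, c ≥ 0`, `m ≥ 1` gives `y ≤ c^{1/m} z`. [folklore] -/
theorem le_rpow_inv_mul_of_pow_le {m : ℕ} (hm : 0 < m) {y z c : ℝ} (hy : 0 ≤ y) (hz : 0 ≤ z)
    (hc : 0 ≤ c) (h : y ^ m ≤ c * z ^ m) : y ≤ c ^ (1 / (m : ℝ)) * z := by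
  have hm0 : (0 : ℝ) < m := by exact_mod_cast hm
  have hroot := Real.rpow_le_rpow (pow_nonneg hy m) h (by positivity : (0 : ℝ) ≤ 1 / (m : ℝ))
  have e1 : (y ^ m) ^ (1 / (m : ℝ)) = y := by
    rw [← Real.rpow_natCast, ← Real.rpow_mul hy]; field_simp; exact Real.rpow_one y
  have e2 : (c * z ^ m) ^ (1 / (m : ℝ)) = c ^ (1 / (m : ℝ)) * z := by
    rw [Real.mul_rpow hc (pow_nonneg hz m), ← Real.rpow_natCast z m, ← Real.rpow_mul hz]
    field_simp; rw [Real.rpow_one]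
  rwa [e1, e2] at hroot

set_option maxHeartbeats 800000 in
/-- **The main-term algebra of §4.**  From the conclusion of Proposition 3.2
(`holder_fourier_bound`) with `A₂ = C_U L² X₃/V`, `∑|u|² ≤ X₃`, `A₁ = B (log log X)^{C₀} L^{2j−1} X₃`,
`L = 2H`, and `V = s^{2j + C₀}` with `log log X ≤ s` (`s = log H`):
`S ≤ (8^j C_U B)^{1/(2j)} · H X₃ / s`.  (Raise to the power `2j`, collect
`A₂ H^j (L X₃)^{j−1} X₃^{j−1} A₁ = 8^j C_U B (LL^{C₀}/V) H^{2j} (H X₃)^{2j}`, use `LL^{C₀}/V ≤ s^{−2j}`, take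
the `2j`-th root.) [cite: LichtmanTeravainen2022, Section 4 (display (4.4))] -/
theorem main_term_algebra {j C₀ : ℕ} (hj : 1 ≤ j) {S H X₃ V LL CU B s : ℝ} (hS : 0 ≤ S)
    (hH : 0 < H) (hX₃ : 0 < X₃) (hs : 0 < s) (hLL0 : 0 ≤ LL) (hLLs : LL ≤ s) (hCU : 0 ≤ CU)
    (hB : 0 ≤ B) (hV : V = s ^ (2 * j + C₀))
    (h : H * S ≤ (CU * (2 * H) ^ 2 * X₃ / V) ^ (1 / (2 * j) : ℝ) * H ^ (1 / 2 : ℝ) *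
      ((2 * H) * X₃) ^ (((j : ℝ) - 1) / (2 * j)) *
      (X₃ ^ (j - 1) * (B * LL ^ C₀ * (2 * H) ^ (2 * j - 1) * X₃)) ^ (1 / (2 * j) : ℝ)) :
    S ≤ (2 ^ (3 * j) * CU * B) ^ (1 / ((2 * j : ℕ) : ℝ)) * (H * X₃ / s) := by
  have hj0 : (0 : ℝ) < j := by exact_mod_cast hj
  have h2j : 0 < 2 * j := by omega
  have hV0 : 0 < V := by rw [hV]; positivity
  set L : ℝ := 2 * H with hL
  have hL0 : 0 < L := by positivity
  -- nonnegativity of the four factors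
  have hA₂0 : 0 ≤ CU * L ^ 2 * X₃ / V := by positivity
  have hA₁0 : 0 ≤ X₃ ^ (j - 1) * (B * LL ^ C₀ * L ^ (2 * j - 1) * X₃) := by positivity
  have hLX0 : 0 ≤ L * X₃ := by positivity
  -- raise to the power `2j`
  have hHS0 : 0 ≤ H * S := by positivity
  have hpow := pow_le_pow_left₀ hHS0 h (2 * j)
  -- simplify the right-hand side
  have hcancel : (1 / (2 * (j : ℝ))) * ((2 * j : ℕ) : ℝ) = 1 := by push_cast; field_simp
  have e1 : ((CU * L ^ 2 * X₃ / V) ^ (1 / (2 * j) : ℝ)) ^ (2 * j) = CU * L ^ 2 * X₃ / V := by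
    rw [← Real.rpow_natCast, ← Real.rpow_mul hA₂0, hcancel, Real.rpow_one]
  have e2 : (H ^ (1 / 2 : ℝ)) ^ (2 * j) = H ^ j := by
    rw [← Real.rpow_natCast, ← Real.rpow_mul hH.le]; push_cast
    rw [show (1 / 2 : ℝ) * (2 * (j : ℝ)) = (j : ℝ) by ring, Real.rpow_natCast]
  have e3 : ((L * X₃) ^ (((j : ℝ) - 1) / (2 * j))) ^ (2 * j) = (L * X₃) ^ (j - 1) := by
    rw [← Real.rpow_natCast, ← Real.rpow_mul hLX0]; push_cast
    rw [show ((j : ℝ) - 1) / (2 * j) * (2 * (j : ℝ)) = (j : ℝ) - 1 by field_simp]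
    rw [show (j : ℝ) - 1 = ((j - 1 : ℕ) : ℝ) by rw [Nat.cast_sub hj]; simp, Real.rpow_natCast]
  have e4 : ((X₃ ^ (j - 1) * (B * LL ^ C₀ * L ^ (2 * j - 1) * X₃)) ^ (1 / (2 * j) : ℝ)) ^ (2 * j) =
      X₃ ^ (j - 1) * (B * LL ^ C₀ * L ^ (2 * j - 1) * X₃) := by
    rw [← Real.rpow_natCast, ← Real.rpow_mul hA₁0, hcancel, Real.rpow_one]
  have hrhs : ((CU * L ^ 2 * X₃ / V) ^ (1 / (2 * j) : ℝ) * H ^ (1 / 2 : ℝ) *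
      (L * X₃) ^ (((j : ℝ) - 1) / (2 * j)) *
      (X₃ ^ (j - 1) * (B * LL ^ C₀ * L ^ (2 * j - 1) * X₃)) ^ (1 / (2 * j) : ℝ)) ^ (2 * j) =
      CU * L ^ 2 * X₃ / V * H ^ j * (L * X₃) ^ (j - 1) *
        (X₃ ^ (j - 1) * (B * LL ^ C₀ * L ^ (2 * j - 1) * X₃)) := by
    rw [mul_pow, mul_pow, mul_pow, e1, e2, e3, e4]
  rw [hrhs] at hpow
  -- collect: the right-hand side is `8^j CU B (LL^{C₀}/V) (H X₃)^{2j}`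
  have hcollect : CU * L ^ 2 * X₃ / V * H ^ j * (L * X₃) ^ (j - 1) *
      (X₃ ^ (j - 1) * (B * LL ^ C₀ * L ^ (2 * j - 1) * X₃)) =
      2 ^ (3 * j) * CU * B * (LL ^ C₀ / V) * (H ^ (2 * j) * (H * X₃) ^ (2 * j)) := by
    rw [hL]
    have hj1 : j = (j - 1) + 1 := (Nat.sub_add_cancel hj).symm
    -- write all powers with exponent `j - 1 =: i`
    set i := j - 1 with hi
    have h2j1 : 2 * j - 1 = 2 * i + 1 := by omega
    have h2j : 2 * j = 2 * i + 2 := by omega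
    have h3j : 3 * j = 3 * i + 3 := by omega
    rw [h2j1, h2j, h3j, hj1]
    field_simp
    ring
  rw [hcollect] at hpow
  -- `LL^{C₀}/V ≤ s^{-2j}`
  have hLLV : LL ^ C₀ / V ≤ 1 / s ^ (2 * j) := by
    rw [hV, pow_add, div_le_div_iff₀ (by positivity) (by positivity), one_mul]
    calc LL ^ C₀ * s ^ (2 * j) ≤ s ^ C₀ * s ^ (2 * j) :=
          mul_le_mul_of_nonneg_right (pow_le_pow_left₀ hLL0 hLLs C₀) (by positivity)
      _ = s ^ (2 * j) * s ^ C₀ := by ring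
  have hK0 : 0 ≤ 2 ^ (3 * j) * CU * B := by positivity
  have hpow' : (H * S) ^ (2 * j) ≤ (2 ^ (3 * j) * CU * B) * (H * (H * X₃ / s)) ^ (2 * j) := by
    have hHX : 0 ≤ H ^ (2 * j) * (H * X₃) ^ (2 * j) := by positivity
    calc (H * S) ^ (2 * j)
        ≤ 2 ^ (3 * j) * CU * B * (LL ^ C₀ / V) * (H ^ (2 * j) * (H * X₃) ^ (2 * j)) := hpow
      _ ≤ 2 ^ (3 * j) * CU * B * (1 / s ^ (2 * j)) * (H ^ (2 * j) * (H * X₃) ^ (2 * j)) :=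
          mul_le_mul_of_nonneg_right (mul_le_mul_of_nonneg_left hLLV hK0) hHX
      _ = (2 ^ (3 * j) * CU * B) * (H * (H * X₃ / s)) ^ (2 * j) := by
          rw [mul_pow H (H * X₃ / s), div_pow, mul_pow H X₃]
          field_simp
  -- take the `2j`-th root
  have hroot := le_rpow_inv_mul_of_pow_le h2j hHS0 (by positivity) hK0 hpow'
  -- cancel `H`
  have : H * S ≤ H * ((2 ^ (3 * j) * CU * B) ^ (1 / ((2 * j : ℕ) : ℝ)) * (H * X₃ / s)) := by
    calc H * S ≤ (2 ^ (3 * j) * CU * B) ^ (1 / ((2 * j : ℕ) : ℝ)) * (H * (H * X₃ / s)) := hroot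
      _ = H * ((2 ^ (3 * j) * CU * B) ^ (1 / ((2 * j : ℕ) : ℝ)) * (H * X₃ / s)) := by ring
  exact le_of_mul_le_mul_left this hH


/-! ### Arithmetic pieces of §4 -/

/-- `|∑_n F(n) ∏_{b ∈ B} f(n+b)| ≤ ∑_n F(n)` for `|f| ≤ 1`, `F = ∏_{a∈A} Λ(n+a) ≥ 0`. [folklore] -/
theorem abs_corr_le_sum_prod (f : ℕ → ℝ) (hf1 : ∀ n, |f n| ≤ 1) (A B : Finset ℕ) (X : ℕ) :
    |∑ n ∈ Icc 1 X, (∏ a ∈ A, Λ (n + a)) * ∏ b ∈ B, f (n + b)| ≤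
      ∑ n ∈ Icc 1 X, ∏ a ∈ A, Λ (n + a) := by
  refine (Finset.abs_sum_le_sum_abs _ _).trans (Finset.sum_le_sum fun n _ => ?_)
  rw [abs_mul, abs_of_nonneg (Finset.prod_nonneg fun a _ => ArithmeticFunction.vonMangoldt_nonneg)]
  refine mul_le_of_le_one_right (Finset.prod_nonneg fun a _ => ArithmeticFunction.vonMangoldt_nonneg) ?_
  rw [Finset.abs_prod]
  exact Finset.prod_le_one (fun b _ => abs_nonneg _) fun b _ => hf1 _

/-- **`E_g ≍ 1`** (§4, from Lemma 2.3): `∑_{n ≤ X} ∏_{a ∈ A} Λ(n + a) ≤ C_A X` for `X ≥ max A`.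
[cite: LichtmanTeravainen2022, Section 4 ("by Lemma 2.3 we can take E_g(X) ≍ 1")] -/
theorem sum_prod_vonMangoldt_le_linear (A : Finset ℕ) : ∃ C : ℝ, 0 < C ∧ ∀ X : ℕ,
    (∀ a ∈ A, a ≤ X) → ∑ n ∈ Icc 1 X, ∏ a ∈ A, Λ (n + a) ≤ C * X := by
  obtain ⟨C, hC, h⟩ := sum_prod_vonMangoldt_le #A
  set S : ℝ := (∏ x ∈ A.offDiag, ((((x.1 : ℤ) - x.2).natAbs : ℕ) : ℝ) /
    Nat.totient (((x.1 : ℤ) - x.2).natAbs)) ^ #A with hS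
  have hS0 : 0 ≤ S := by positivity
  refine ⟨C * (S + 1), by positivity, fun X hAX => ?_⟩
  have h1 := h X A le_rfl hAX
  have hX34 : ((X : ℝ)) ^ (3 / 4 : ℝ) ≤ X := by
    rcases Nat.eq_zero_or_pos X with rfl | hX
    · simp
    · have hX1 : (1 : ℝ) ≤ X := by exact_mod_cast hX
      calc ((X : ℝ)) ^ (3 / 4 : ℝ) ≤ ((X : ℝ)) ^ (1 : ℝ) :=
            Real.rpow_le_rpow_of_exponent_le hX1 (by norm_num)
        _ = X := Real.rpow_one _
  calc _ ≤ C * (X * S + ((X : ℝ)) ^ (3 / 4 : ℝ)) := h1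
    _ ≤ C * (X * S + X) := by gcongr
    _ = C * (S + 1) * X := by ring

/-- **Lemma 2.5 in §4**: `∑_{h ≤ H} ∏_{a ∈ A} |h − a|/φ(|h − a|) ≤ C (H + max A + 1)` over the `h ∉ A`
(bounding each factor by `max(1, ·)`, the product by the sum of `#A`-th powers, and each of those
by `sum_weight_shift_le`). [cite: LichtmanTeravainen2022, Section 4 (display before (4.2))] -/
theorem sum_prod_weight_le (A : Finset ℕ) (hA : A.Nonempty) : ∃ C : ℝ, 0 < C ∧ ∀ (H D : ℕ),
    (∀ a ∈ A, a ≤ D) →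
    ∑ h ∈ (Icc 1 H).filter (fun h => h ∉ A),
        ∏ a ∈ A, (((((h : ℤ) - a).natAbs : ℕ) : ℝ) / Nat.totient (((h : ℤ) - a).natAbs)) ≤
      C * ((H : ℝ) + D + 1) := by
  obtain ⟨C, hC, h1⟩ := sum_weight_shift_le #A
  refine ⟨C * #A, by have := Finset.card_pos.mpr hA; positivity, fun H D hAD => ?_⟩
  set r : ℤ → ℝ := fun z => max 1 (((z.natAbs : ℕ) : ℝ) / Nat.totient z.natAbs) with hr
  have hr1 : ∀ z, 1 ≤ r z := fun z => le_max_left _ _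
  calc ∑ h ∈ (Icc 1 H).filter (fun h => h ∉ A),
        ∏ a ∈ A, (((((h : ℤ) - a).natAbs : ℕ) : ℝ) / Nat.totient (((h : ℤ) - a).natAbs))
      ≤ ∑ h ∈ (Icc 1 H).filter (fun h => h ∉ A), ∏ a ∈ A, r ((h : ℤ) - a) := by
        refine Finset.sum_le_sum fun h _ => Finset.prod_le_prod (fun a _ => by positivity)
          fun a _ => le_max_right _ _
    _ ≤ ∑ h ∈ Icc 1 H, ∏ a ∈ A, r ((h : ℤ) - a) :=
        Finset.sum_le_sum_of_subset_of_nonneg (Finset.filter_subset _ _) fun h _ _ =>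
          Finset.prod_nonneg fun a _ => by linarith [hr1 ((h : ℤ) - a)]
    _ ≤ ∑ h ∈ Icc 1 H, ∑ a ∈ A, r ((h : ℤ) - a) ^ #A :=
        Finset.sum_le_sum fun h _ => prod_le_sum_pow_card A hA _ fun a _ => hr1 _
    _ = ∑ a ∈ A, ∑ h ∈ Icc 1 H, r ((h : ℤ) - a) ^ #A := Finset.sum_comm
    _ ≤ ∑ a ∈ A, C * ((H : ℝ) + D + 1) := by
        refine Finset.sum_le_sum fun a ha => ?_
        have h2 := h1 H (-(a : ℤ))
        have heq : ∀ h : ℕ, (h : ℤ) - a = (h : ℤ) + -(a : ℤ) := fun h => by ring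
        simp_rw [hr, heq]
        refine h2.trans (mul_le_mul_of_nonneg_left ?_ hC.le)
        have : |((-(a : ℤ) : ℤ) : ℝ)| = a := by push_cast; rw [abs_neg]; exact abs_of_nonneg (Nat.cast_nonneg _)
        rw [this]
        have := hAD a ha
        have : (a : ℝ) ≤ D := by exact_mod_cast this
        linarith
    _ = C * #A * ((H : ℝ) + D + 1) := by rw [Finset.sum_const, nsmul_eq_mul]; ring

/-- `MRT2015.HasFactorIn n P Q ↔ HasPrimeFactorIn P Q n` for `n ≠ 0`. [folklore] -/
theorem hasFactorIn_iff_hasPrimeFactorIn {n : ℕ} (hn : n ≠ 0) (P Q : ℝ) :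
    HasFactorIn n P Q ↔ HasPrimeFactorIn P Q n := by
  constructor
  · rintro ⟨p, hp, hpn, hP, hQ⟩
    exact ⟨p, Nat.mem_primeFactors.mpr ⟨hp, hpn, hn⟩, hP, hQ⟩
  · rintro ⟨p, hp, hP, hQ⟩
    have := Nat.mem_primeFactors.mp hp
    exact ⟨p, this.1, this.2.1, hP, hQ⟩


/-! ### §4: the proof of Theorem 1.2 (i) from Propositions 2.1, 2.7, 3.2 and Lemmas 2.3, 2.5, 2.11 -/

/-- Pointwise comparison of the two "no prime factor in `[P, Q]`" indicators (`n ≠ 0`), with the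
weight `F` attached. [folklore] -/
theorem mul_indicator_hasFactorIn_eq {n : ℕ} (hn : n ≠ 0) (P Q F : ℝ) :
    F * (if HasFactorIn n P Q then (0 : ℝ) else 1) = if HasPrimeFactorIn P Q n then 0 else F := by
  by_cases h : HasPrimeFactorIn P Q n
  · rw [if_pos h, if_pos ((hasFactorIn_iff_hasPrimeFactorIn hn P Q).mpr h), mul_zero]
  · rw [if_neg h, if_neg (fun h' => h ((hasFactorIn_iff_hasPrimeFactorIn hn P Q).mp h')), mul_one]


/-! ### §4: the choice of parameters (`V = (log H)^{p₀}`, `a = 1/(625 p₀)`) and their sizes -/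

set_option maxHeartbeats 1600000 in
/-- **The parameter regime of §4.**  For `p₀ ≥ 2` and constants `C_f, V₀, D` there is `T` such
that for all natural `X ≥ e^T` and `H` with `(log X)^κ ≤ H ≤ exp((log X)^{1/(625 p₀)})` (`κ ≥ 1`),
writing `t = log X`, `s = log H`, `V = s^{p₀}`: `t > 0`, `H ≥ T`, `s ≥ 1`, `log t ≤ s ≤ t`,
`log s ≥ 1`, `2H² ≤ X`, `V ≥ V₀`, `V ≥ 4`, and the hypotheses of Matomäki–Radziwiłł–Tao's
Theorem 2.3 (`V⁵ ≤ t^{1/125}`, `V^{1015} ≤ 2H`, `2H V^{75} ≤ X`, `log 2H ≤ V`,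
`15 log V ≤ ¼ log t − C_f`), as well as `30 p₀ log s ≤ s` and `t s ≤ X^{1/4}`.
[cite: LichtmanTeravainen2022, Section 4 (choice of `δ`, `p`) and Proposition 2.1 (proof)] -/
theorem hlc_params (p₀ : ℕ) (hp₀ : 2 ≤ p₀) (Cf V₀ : ℝ) (D : ℕ) :
    ∃ T : ℝ, 64 ≤ T ∧ (D : ℝ) + 1 ≤ T ∧ ∀ (X H : ℕ) (κ : ℝ), 1 ≤ κ →
      Real.exp T ≤ X → Real.log X ^ κ ≤ H →
      (H : ℝ) ≤ Real.exp (Real.log X ^ (1 / (625 * (p₀ : ℝ)))) →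
      0 < Real.log X ∧ T ≤ H ∧ 4 ≤ Real.log H ∧ Real.log (Real.log X) ≤ Real.log H ∧
      Real.log H ≤ Real.log X ∧ 1 ≤ Real.log (Real.log H) ∧ 2 * (H : ℝ) ^ 2 ≤ X ∧
      V₀ ≤ Real.log H ^ p₀ ∧ 4 ≤ Real.log H ^ p₀ ∧
      (Real.log H ^ p₀) ^ 5 ≤ Real.log X ^ (1 / 125 : ℝ) ∧
      (Real.log H ^ p₀) ^ 1015 ≤ ((2 * H : ℕ) : ℝ) ∧
      ((2 * H : ℕ) : ℝ) * (Real.log H ^ p₀) ^ 75 ≤ X ∧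
      Real.log ((2 * H : ℕ) : ℝ) ≤ Real.log H ^ p₀ ∧
      15 * Real.log (Real.log H ^ p₀) ≤ (1 / 4) * Real.log (Real.log X) - Cf ∧
      30 * p₀ * Real.log (Real.log H) ≤ Real.log H ∧
      Real.log X * Real.log H ≤ (X : ℝ) ^ (1 / 4 : ℝ) := by
  have hp₀R : (2 : ℝ) ≤ p₀ := by exact_mod_cast hp₀
  have hp₀pos : (0 : ℝ) < p₀ := by linarith only [hp₀R]
  set a : ℝ := 1 / (625 * (p₀ : ℝ)) with ha
  have ha0 : 0 < a := by rw [ha]; positivity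
  have ha1 : a ≤ 1 / 2 := by
    rw [ha, div_le_div_iff₀ (by positivity) (by norm_num)]; linarith only [hp₀R]
  -- growth thresholds
  obtain ⟨H₁, hH₁⟩ := exists_pow_log_le_self (1015 * p₀)
  obtain ⟨H₂, hH₂⟩ := exists_pow_log_le_self (75 * p₀)
  obtain ⟨s₁, hs₁1, hs₁⟩ := exists_mul_log_le_self (30 * p₀)
  obtain ⟨H₃, hH₃⟩ := exists_pow_log_le_self 3
  set T : ℝ := 64 + ((D : ℝ) + 1) + Real.exp (5 * |Cf|) + 4 * |Real.log H₃| + |H₁| + |H₂| +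
    Real.exp s₁ + Real.exp |V₀| with hT
  have hD0 : (0 : ℝ) ≤ D := Nat.cast_nonneg D
  have e1 := Real.exp_pos (5 * |Cf|)
  have e2 := abs_nonneg (Real.log H₃)
  have e3 := abs_nonneg H₁
  have e4 := abs_nonneg H₂
  have e5 := Real.exp_pos s₁
  have e6 := Real.exp_pos |V₀|
  have hT64 : 64 ≤ T := by rw [hT]; linarith only [hD0, e1, e2, e3, e4, e5, e6]
  have hTD : (D : ℝ) + 1 ≤ T := by rw [hT]; linarith only [hD0, e1, e2, e3, e4, e5, e6]
  have hTCf : Real.exp (5 * |Cf|) ≤ T := by rw [hT]; linarith only [hD0, e1, e2, e3, e4, e5, e6]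
  have hTH₃ : 4 * |Real.log H₃| ≤ T := by rw [hT]; linarith only [hD0, e1, e2, e3, e4, e5, e6]
  have hTH₁ : H₁ ≤ T := by
    rw [hT]; linarith only [hD0, e1, e2, le_abs_self H₁, e4, e5, e6]
  have hTH₂ : H₂ ≤ T := by
    rw [hT]; linarith only [hD0, e1, e2, e3, le_abs_self H₂, e5, e6]
  have hTs₁ : Real.exp s₁ ≤ T := by rw [hT]; linarith only [hD0, e1, e2, e3, e4, e5, e6]
  have hTV₀ : Real.exp |V₀| ≤ T := by rw [hT]; linarith only [hD0, e1, e2, e3, e4, e5, e6]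
  have hT0 : 0 < T := by linarith only [hT64]
  refine ⟨T, hT64, hTD, ?_⟩
  intro X H κ hκ hXT hHlow hHup
  -- `t = log X`
  have hX0 : (0 : ℝ) < X := lt_of_lt_of_le (Real.exp_pos T) hXT
  set t : ℝ := Real.log X with ht
  have htT : T ≤ t := by rw [ht, ← Real.log_exp T]; exact Real.log_le_log (Real.exp_pos T) hXT
  have ht64 : 64 ≤ t := hT64.trans htT
  have ht1 : 1 ≤ t := by linarith only [ht64]
  have ht0 : 0 < t := by linarith only [ht64]
  have hXexp : (X : ℝ) = Real.exp t := by rw [ht, Real.exp_log hX0]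
  -- `H ≥ t^κ ≥ t ≥ T`
  have hHt : t ≤ H := by
    calc t = t ^ (1 : ℝ) := (Real.rpow_one t).symm
      _ ≤ t ^ κ := Real.rpow_le_rpow_of_exponent_le ht1 hκ
      _ ≤ H := hHlow
  have hHT : T ≤ (H : ℝ) := htT.trans hHt
  have hH64 : (64 : ℝ) ≤ H := hT64.trans hHT
  have hH0 : (0 : ℝ) < H := by linarith only [hH64]
  -- `s = log H`
  set s : ℝ := Real.log H with hs
  have hlogt0 : 0 ≤ Real.log t := Real.log_nonneg ht1
  have hts : Real.log t ≤ s := by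
    have h1 : κ * Real.log t ≤ s := by
      rw [hs, ← Real.log_rpow ht0]
      exact Real.log_le_log (Real.rpow_pos_of_pos ht0 _) hHlow
    have h2 : 1 * Real.log t ≤ κ * Real.log t := mul_le_mul_of_nonneg_right hκ hlogt0
    linarith only [h1, h2]
  have hsT : Real.log T ≤ s := by rw [hs]; exact Real.log_le_log hT0 hHT
  have hs4 : 4 ≤ s := by
    have h1 : Real.log 64 ≤ s := le_trans (Real.log_le_log (by norm_num) hT64) hsT
    have h2 : (4 : ℝ) ≤ Real.log 64 := by
      rw [show (64 : ℝ) = 2 ^ 6 by norm_num, Real.log_pow]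
      have := Real.log_two_gt_d9
      push_cast
      linarith only [this]
    linarith only [h1, h2]
  have hs1 : 1 ≤ s := by linarith only [hs4]
  have hs0 : 0 < s := by linarith only [hs4]
  have hsup : s ≤ t ^ a := by
    rw [hs, ← Real.log_exp (t ^ a)]; exact Real.log_le_log hH0 hHup
  have hta_le : t ^ a ≤ t ^ (1 / 2 : ℝ) := Real.rpow_le_rpow_of_exponent_le ht1 ha1
  have hsqrt_t : t ^ (1 / 2 : ℝ) * t ^ (1 / 2 : ℝ) = t := by
    rw [← Real.rpow_add ht0]; norm_num
  have ht12_0 : 0 ≤ t ^ (1 / 2 : ℝ) := Real.rpow_nonneg ht0.le _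
  have ht4 : 4 ≤ t ^ (1 / 2 : ℝ) := by
    have h1 : (16 : ℝ) ^ (1 / 2 : ℝ) ≤ t ^ (1 / 2 : ℝ) :=
      Real.rpow_le_rpow (by norm_num) (by linarith only [ht64]) (by norm_num)
    have h16 : (16 : ℝ) ^ (1 / 2 : ℝ) = 4 := by
      rw [show (16 : ℝ) = 4 ^ (2 : ℝ) by norm_num, ← Real.rpow_mul (by norm_num)]; norm_num
    rwa [h16] at h1
  have hsqrt_le : t ^ (1 / 2 : ℝ) ≤ t / 4 := by
    have := mul_le_mul_of_nonneg_right ht4 ht12_0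
    linarith only [this, hsqrt_t]
  have hst : s ≤ t := by
    calc s ≤ t ^ (1 / 2 : ℝ) := hsup.trans hta_le
      _ ≤ t / 4 := hsqrt_le
      _ ≤ t := by linarith only [ht0]
  have hlogs1 : 1 ≤ Real.log s := by
    rw [← Real.log_exp 1]
    refine Real.log_le_log (Real.exp_pos 1) ?_
    have := Real.exp_one_lt_d9
    linarith only [this, hs4]
  -- `2H² ≤ X`
  have h2H2 : 2 * (H : ℝ) ^ 2 ≤ X := by
    have h1 : (H : ℝ) ≤ Real.exp (t ^ (1 / 2 : ℝ)) := hHup.trans (Real.exp_le_exp.mpr hta_le)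
    have h2 : (H : ℝ) ^ 2 ≤ Real.exp (t ^ (1 / 2 : ℝ)) ^ 2 := pow_le_pow_left₀ hH0.le h1 2
    rw [hXexp]
    have h3 : (2 : ℝ) ≤ Real.exp 1 := by
      have := Real.add_one_le_exp (1 : ℝ); linarith only [this]
    have h5 : Real.exp (t ^ (1 / 2 : ℝ)) ^ 2 = Real.exp (2 * t ^ (1 / 2 : ℝ)) := by
      rw [← Real.exp_nat_mul]; norm_num
    have h6 : 1 + 2 * t ^ (1 / 2 : ℝ) ≤ t := by linarith only [hsqrt_le, ht64, ht4]
    calc 2 * (H : ℝ) ^ 2 ≤ 2 * Real.exp (t ^ (1 / 2 : ℝ)) ^ 2 := by linarith only [h2]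
      _ ≤ Real.exp 1 * Real.exp (2 * t ^ (1 / 2 : ℝ)) := by
          rw [h5]; exact mul_le_mul_of_nonneg_right h3 (Real.exp_pos _).le
      _ = Real.exp (1 + 2 * t ^ (1 / 2 : ℝ)) := by rw [← Real.exp_add]
      _ ≤ Real.exp t := Real.exp_le_exp.mpr h6
  have hLR : ((2 * H : ℕ) : ℝ) = 2 * (H : ℝ) := by push_cast; ring
  -- `V = s^{p₀}`
  set V : ℝ := s ^ p₀ with hV
  have hVs : s ≤ V := by rw [hV]; exact le_self_pow₀ hs1 (by omega)
  have hV4 : 4 ≤ V := hs4.trans hVs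
  have hV2 : s ^ 2 ≤ V := by rw [hV]; exact pow_le_pow_right₀ hs1 hp₀
  have hlogV : Real.log V = p₀ * Real.log s := by rw [hV, Real.log_pow]
  -- `V₀ ≤ V`
  have hV₀ : V₀ ≤ V := by
    have h1 : |V₀| ≤ s := by
      have : Real.log (Real.exp |V₀|) ≤ s := le_trans (Real.log_le_log (Real.exp_pos _) hTV₀) hsT
      rwa [Real.log_exp] at this
    linarith only [le_abs_self V₀, h1, hVs]
  -- `V^5 ≤ t^{1/125}`
  have hc1 : V ^ 5 ≤ Real.log X ^ (1 / 125 : ℝ) := by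
    rw [← ht]
    calc V ^ 5 = s ^ (5 * p₀) := by rw [hV, ← pow_mul, mul_comm]
      _ ≤ (t ^ a) ^ (5 * p₀) := pow_le_pow_left₀ hs0.le hsup _
      _ = t ^ (1 / 125 : ℝ) := by
          rw [← Real.rpow_natCast, ← Real.rpow_mul ht0.le]
          congr 1
          rw [ha]; push_cast; field_simp; ring
  -- `V^{1015} ≤ 2H`
  have hc2 : V ^ 1015 ≤ ((2 * H : ℕ) : ℝ) := by
    rw [hLR]
    calc V ^ 1015 = s ^ (1015 * p₀) := by rw [hV, ← pow_mul, mul_comm]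
      _ ≤ H := hH₁ H (hTH₁.trans hHT)
      _ ≤ 2 * H := by linarith only [hH0]
  -- `2H V^{75} ≤ X`
  have hc3 : ((2 * H : ℕ) : ℝ) * V ^ 75 ≤ X := by
    rw [hLR]
    have h1 : V ^ 75 ≤ H := by
      calc V ^ 75 = s ^ (75 * p₀) := by rw [hV, ← pow_mul, mul_comm]
        _ ≤ H := hH₂ H (hTH₂.trans hHT)
    calc 2 * (H : ℝ) * V ^ 75 ≤ 2 * H * H := mul_le_mul_of_nonneg_left h1 (by positivity)
      _ = 2 * (H : ℝ) ^ 2 := by ring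
      _ ≤ X := h2H2
  -- `log 2H ≤ V`
  have hc4 : Real.log ((2 * H : ℕ) : ℝ) ≤ V := by
    rw [hLR, Real.log_mul (by norm_num) hH0.ne', ← hs]
    have h1 : Real.log 2 ≤ 1 := by
      have := Real.log_two_lt_d9; linarith only [this]
    have h2 : s * 2 ≤ s * s := mul_le_mul_of_nonneg_left (by linarith only [hs4]) hs0.le
    have h3 : s ^ 2 = s * s := sq s
    linarith only [h1, h2, h3, hV2, hs1]
  -- `15 log V ≤ ¼ log t − Cf`
  have hc5 : 15 * Real.log V ≤ (1 / 4) * Real.log (Real.log X) - Cf := by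
    rw [← ht, hlogV]
    have h1 : Real.log s ≤ a * Real.log t := by
      rw [← Real.log_rpow ht0]; exact Real.log_le_log hs0 hsup
    have h2 : 5 * |Cf| ≤ Real.log t := by
      have : Real.log (Real.exp (5 * |Cf|)) ≤ Real.log t :=
        Real.log_le_log (Real.exp_pos _) (hTCf.trans htT)
      rwa [Real.log_exp] at this
    have h3 : (p₀ : ℝ) * (a * Real.log t) = Real.log t / 625 := by
      rw [ha]; field_simp
    have h4 : (p₀ : ℝ) * Real.log s ≤ Real.log t / 625 := by
      rw [← h3]; exact mul_le_mul_of_nonneg_left h1 hp₀pos.le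
    linarith only [h4, h2, le_abs_self Cf, hlogt0]
  -- `30 p₀ log s ≤ s`
  have hs₁' : s₁ ≤ s := by
    have : Real.log (Real.exp s₁) ≤ s := le_trans (Real.log_le_log (Real.exp_pos _) hTs₁) hsT
    rwa [Real.log_exp] at this
  have h30 : 30 * p₀ * Real.log s ≤ s := hs₁ s hs₁'
  -- `t s ≤ X^{1/4}`
  have hX14 : Real.exp (t / 4) = (X : ℝ) ^ (1 / 4 : ℝ) := by
    rw [Real.rpow_def_of_pos hX0, ← ht]; ring_nf
  have hjunk : t * s ≤ (X : ℝ) ^ (1 / 4 : ℝ) := by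
    have hy : H₃ ≤ Real.exp (t / 4) := by
      rcases le_or_gt H₃ 0 with h0 | h0
      · exact h0.trans (Real.exp_pos _).le
      · have h1 : Real.log H₃ ≤ t / 4 := by
          linarith only [le_abs_self (Real.log H₃), hTH₃, htT]
        calc H₃ = Real.exp (Real.log H₃) := (Real.exp_log h0).symm
          _ ≤ Real.exp (t / 4) := Real.exp_le_exp.mpr h1
    have h3 := hH₃ (Real.exp (t / 4)) hy
    rw [Real.log_exp] at h3
    have h4 : t * s ≤ t * t := mul_le_mul_of_nonneg_left hst ht0.le
    have h5 : t * t * 64 ≤ t * t * t := mul_le_mul_of_nonneg_left ht64 (by positivity)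
    have h6 : (t / 4) ^ 3 = t * t * t / 64 := by ring
    rw [← hX14]
    linarith only [h3, h4, h5, h6]
  exact ⟨ht0, hHT, hs4, hts, hst, hlogs1, h2H2, hV₀, hV4, hc1, hc2, hc3, hc4, hc5, h30, hjunk⟩

/-- **The first interval `[P₁, Q₁] = [W^{200}, 2H/W³]`** (`W = V⁵`, `V = s^{p₀}`, `s = log H`):
`P₁ ≥ 2`, `P₁ ≤ Q₁`, `log Q₁ ≥ 1` and `log P₁/log Q₁ ≤ 2000 p₀ (log s)/s` (the paper's
"`log P₁/log Q₁ ≪ log W/log H ≪ δ`", proof of Proposition 2.1).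
[cite: LichtmanTeravainen2022, Proposition 2.1 (proof)] -/
theorem pq_facts (p₀ : ℕ) {s V L : ℝ} (hs4 : 4 ≤ s) (hV : V = s ^ p₀) (hV4 : 4 ≤ V)
    (hL0 : 0 < L) (hVL : V ^ 1015 ≤ L) (hsL : s ≤ Real.log L)
    (h30 : 30 * p₀ * Real.log (s) ≤ s) :
    2 ≤ (V ^ 5) ^ 200 ∧ (V ^ 5) ^ 200 ≤ L / (V ^ 5) ^ 3 ∧ 0 < L / (V ^ 5) ^ 3 ∧
    0 ≤ Real.log ((V ^ 5) ^ 200) ∧ 1 ≤ Real.log (L / (V ^ 5) ^ 3) ∧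
    Real.log ((V ^ 5) ^ 200) / Real.log (L / (V ^ 5) ^ 3) ≤ 2000 * p₀ * (Real.log s / s) := by
  have hs0 : 0 < s := by linarith only [hs4]
  have hs1 : 1 ≤ s := by linarith only [hs4]
  have hV1 : 1 < V := by linarith only [hV4]
  have hV0 : 0 < V := by linarith only [hV4]
  have hP : (V ^ 5) ^ 200 = V ^ 1000 := by rw [← pow_mul]
  have hQ : L / (V ^ 5) ^ 3 = L / V ^ 15 := by rw [← pow_mul]
  rw [hP, hQ]
  have hlogV : Real.log V = p₀ * Real.log s := by rw [hV, Real.log_pow]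
  have hlogs : 0 ≤ Real.log s := Real.log_nonneg hs1
  have hp₀0 : (0 : ℝ) ≤ p₀ := Nat.cast_nonneg p₀
  -- `P₁ ≥ 2`
  have hP2 : (2 : ℝ) ≤ V ^ 1000 := by
    calc (2 : ℝ) ≤ 4 := by norm_num
      _ ≤ V := hV4
      _ ≤ V ^ 1000 := le_self_pow₀ hV1.le (by norm_num)
  -- `P₁ ≤ Q₁`
  have hPQ : V ^ 1000 ≤ L / V ^ 15 := by
    rw [le_div_iff₀ (by positivity)]
    calc V ^ 1000 * V ^ 15 = V ^ 1015 := by rw [← pow_add]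
      _ ≤ L := hVL
  have hQ0 : 0 < L / V ^ 15 := by positivity
  -- logs
  have hlogP : Real.log (V ^ 1000) = 1000 * (p₀ * Real.log s) := by
    rw [Real.log_pow, hlogV]; push_cast; ring
  have hlog4 : 1 ≤ Real.log 4 := by
    rw [← Real.log_exp 1]
    refine Real.log_le_log (Real.exp_pos 1) ?_
    have := Real.exp_one_lt_d9; linarith only [this]
  have hlogV1 : 1 ≤ Real.log V := hlog4.trans (Real.log_le_log (by norm_num) hV4)
  have hlogP1 : 1 ≤ Real.log (V ^ 1000) := by
    rw [Real.log_pow]; push_cast; nlinarith only [hlogV1]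
  have hlogP0 : 0 ≤ Real.log (V ^ 1000) := by linarith only [hlogP1]
  have hlogPQ : Real.log (V ^ 1000) ≤ Real.log (L / V ^ 15) :=
    Real.log_le_log (by positivity) hPQ
  have hlogQ1 : 1 ≤ Real.log (L / V ^ 15) := hlogP1.trans hlogPQ
  have hlogQ0 : 0 < Real.log (L / V ^ 15) := by linarith only [hlogQ1]
  -- `log Q₁ ≥ s/2`
  have hlQ : s / 2 ≤ Real.log (L / V ^ 15) := by
    rw [Real.log_div hL0.ne' (by positivity), Real.log_pow, hlogV]
    push_cast
    nlinarith only [hsL, h30, hlogs, hp₀0]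
  refine ⟨hP2, hPQ, hQ0, hlogP0, hlogQ1, ?_⟩
  rw [div_le_iff₀ hlogQ0, hlogP]
  have h1 : 2000 * (p₀ : ℝ) * (Real.log s / s) * (s / 2) ≤
      2000 * (p₀ : ℝ) * (Real.log s / s) * Real.log (L / V ^ 15) :=
    mul_le_mul_of_nonneg_left hlQ (by positivity)
  have e : 2000 * (p₀ : ℝ) * (Real.log s / s) * (s / 2) = 1000 * (p₀ * Real.log s) := by
    field_simp
    ring
  linarith only [h1, e]

set_option maxHeartbeats 1600000 in
/-- **The exceptional set (display (4.1)–(4.2) of the paper).**  For fixed `A ≠ ∅`, `B'` there is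
`C` such that for all `X, H`, index sets `JS` and intervals `[P_j, Q_j]` with
`2 ≤ P_j ≤ Q_j ≤ X^{1/4}` (and `a ≤ X`, `a + 1 ≤ H` for `a ∈ A`),
`∑_{h ≤ H, h ∉ A∪B'} ∑_{n ≤ X} ∏_{a∈A} Λ(n+a) ∑_{j ∈ JS} 1[n+h has no prime factor in [P_j,Q_j]]
 ≤ C (X H ∑_j log P_j/log Q_j + #JS · H · X^{3/4})` — Lemma 2.11
(`sum_indicator_prod_vonMangoldt_le`) for each `j, h`, then Lemma 2.5 (`sum_prod_weight_le`) in `h`.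
[cite: LichtmanTeravainen2022, Section 4, displays (4.1)–(4.2)] -/
theorem exceptional_sum_le (A B' : Finset ℕ) (hA : A.Nonempty) : ∃ C : ℝ, 0 < C ∧
    ∀ (X H : ℕ) (JS : Finset ℕ) (P Q : ℕ → ℝ), (∀ a ∈ A, a ≤ X) → (∀ a ∈ A, (a : ℝ) + 1 ≤ H) →
    (∀ j ∈ JS, 2 ≤ P j ∧ P j ≤ Q j ∧ Q j ≤ (X : ℝ) ^ (1 / 4 : ℝ)) →
    ∑ h ∈ (Icc 1 H).filter (fun h => h ∉ A ∪ B'), ∑ n ∈ Icc 1 X,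
        (∏ a ∈ A, Λ (n + a)) * ∑ j ∈ JS, (if HasFactorIn (n + h) (P j) (Q j) then (0 : ℝ) else 1) ≤
      C * ((X : ℝ) * H * ∑ j ∈ JS, Real.log (P j) / Real.log (Q j) +
        #JS * H * ((X : ℝ)) ^ (3 / 4 : ℝ)) := by
  obtain ⟨CE, hCE, hExc⟩ := sum_indicator_prod_vonMangoldt_le #A
  obtain ⟨CW, hCW, hWt⟩ := sum_prod_weight_le A hA
  set SA : ℝ := (∏ x ∈ A.offDiag, ((((x.1 : ℤ) - x.2).natAbs : ℕ) : ℝ) /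
    Nat.totient (((x.1 : ℤ) - x.2).natAbs)) ^ #A with hSA
  have hSA0 : 0 ≤ SA := by positivity
  refine ⟨3 * CE * SA * CW + CE, by positivity, ?_⟩
  intro X H JS P Q hAX hAH hPQ
  set D : ℕ := A.sup id with hD
  have hAD : ∀ x ∈ A, x ≤ D := fun x hx => Finset.le_sup (f := id) hx
  have hDH : (D : ℝ) + 1 ≤ H := by
    obtain ⟨x, hx, hxD⟩ := Finset.exists_mem_eq_sup A hA id
    rw [hD, hxD]; exact hAH x hx
  have hH1 : (1 : ℝ) ≤ H := by linarith only [hDH, (Nat.cast_nonneg D : (0 : ℝ) ≤ D)]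
  set Hg := (Icc 1 H).filter (fun h => h ∉ A ∪ B') with hHg
  set F : ℕ → ℝ := fun n => ∏ a ∈ A, Λ (n + a) with hF
  -- one `(j, h)`
  have hExc_h : ∀ j ∈ JS, ∀ h ∈ Hg,
      ∑ n ∈ Icc 1 X, F n * (if HasFactorIn (n + h) (P j) (Q j) then (0 : ℝ) else 1) ≤
        CE * (X * SA * (Real.log (P j) / Real.log (Q j)) *
          ∏ a ∈ A, (((((h : ℤ) - a).natAbs : ℕ) : ℝ) / Nat.totient (((h : ℤ) - a).natAbs))
          + ((X : ℝ)) ^ (3 / 4 : ℝ)) := by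
    intro j hj h hh
    have hhmem := Finset.mem_filter.mp hh
    have hh1 := (Finset.mem_Icc.mp hhmem.1).1
    have hhA : h ∉ A := fun h' => hhmem.2 (Finset.mem_union_left _ h')
    obtain ⟨hP2, hPQ', hQX⟩ := hPQ j hj
    have heq : ∀ n ∈ Icc 1 X,
        F n * (if HasFactorIn (n + h) (P j) (Q j) then (0 : ℝ) else 1) =
        (if HasPrimeFactorIn (P j) (Q j) (n + h) then 0 else ∏ a ∈ A, Λ (n + a)) :=
      fun n _ => mul_indicator_hasFactorIn_eq (by omega) _ _ _
    rw [Finset.sum_congr rfl heq]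
    exact hExc X A h _ _ le_rfl hAX hhA hP2 hPQ' hQX
  -- Lemma 2.5 in `h`
  have hWsum : ∑ h ∈ Hg, ∏ a ∈ A, (((((h : ℤ) - a).natAbs : ℕ) : ℝ) / Nat.totient (((h : ℤ) - a).natAbs))
      ≤ CW * (3 * H) := by
    have h1 := hWt H D hAD
    have hsub : Hg ⊆ (Icc 1 H).filter (fun h => h ∉ A) := by
      intro h hh
      have := Finset.mem_filter.mp hh
      exact Finset.mem_filter.mpr ⟨this.1, fun h' => this.2 (Finset.mem_union_left _ h')⟩
    calc _ ≤ ∑ h ∈ (Icc 1 H).filter (fun h => h ∉ A),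
          ∏ a ∈ A, (((((h : ℤ) - a).natAbs : ℕ) : ℝ) / Nat.totient (((h : ℤ) - a).natAbs)) :=
          Finset.sum_le_sum_of_subset_of_nonneg hsub fun h _ _ => by positivity
      _ ≤ CW * ((H : ℝ) + D + 1) := h1
      _ ≤ CW * (3 * H) := by
          refine mul_le_mul_of_nonneg_left ?_ hCW.le
          linarith only [hDH, hH1]
  have hHgcard : (#Hg : ℝ) ≤ H := by
    calc (#Hg : ℝ) ≤ #(Icc 1 H) := by exact_mod_cast Finset.card_le_card (Finset.filter_subset _ _)
      _ = H := by rw [Nat.card_Icc]; push_cast; simp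
  have hX34_0 : 0 ≤ ((X : ℝ)) ^ (3 / 4 : ℝ) := by positivity
  -- swap the sums
  have hswap : ∑ h ∈ Hg, ∑ n ∈ Icc 1 X,
      F n * ∑ j ∈ JS, (if HasFactorIn (n + h) (P j) (Q j) then (0 : ℝ) else 1) =
      ∑ j ∈ JS, ∑ h ∈ Hg, ∑ n ∈ Icc 1 X,
        F n * (if HasFactorIn (n + h) (P j) (Q j) then (0 : ℝ) else 1) := by
    calc ∑ h ∈ Hg, ∑ n ∈ Icc 1 X,
          F n * ∑ j ∈ JS, (if HasFactorIn (n + h) (P j) (Q j) then (0 : ℝ) else 1)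
        = ∑ h ∈ Hg, ∑ n ∈ Icc 1 X, ∑ j ∈ JS,
            F n * (if HasFactorIn (n + h) (P j) (Q j) then (0 : ℝ) else 1) :=
          Finset.sum_congr rfl fun h _ => Finset.sum_congr rfl fun n _ => Finset.mul_sum _ _ _
      _ = ∑ h ∈ Hg, ∑ j ∈ JS, ∑ n ∈ Icc 1 X,
            F n * (if HasFactorIn (n + h) (P j) (Q j) then (0 : ℝ) else 1) :=
          Finset.sum_congr rfl fun h _ => Finset.sum_comm
      _ = _ := Finset.sum_comm
  rw [hswap]
  have hjbound : ∀ j ∈ JS, ∑ h ∈ Hg, ∑ n ∈ Icc 1 X,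
      F n * (if HasFactorIn (n + h) (P j) (Q j) then (0 : ℝ) else 1) ≤
      3 * CE * SA * CW * (X * H * (Real.log (P j) / Real.log (Q j))) +
        CE * (H * ((X : ℝ)) ^ (3 / 4 : ℝ)) := by
    intro j hj
    have hρ0 : 0 ≤ Real.log (P j) / Real.log (Q j) := by
      obtain ⟨hP2, hPQ', _⟩ := hPQ j hj
      exact div_nonneg (Real.log_nonneg (by linarith only [hP2]))
        (Real.log_nonneg (by linarith only [hP2, hPQ']))
    have hc0 : 0 ≤ CE * (X * SA * (Real.log (P j) / Real.log (Q j))) := by positivity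
    calc _ ≤ ∑ h ∈ Hg, CE * (X * SA * (Real.log (P j) / Real.log (Q j)) *
          ∏ a ∈ A, (((((h : ℤ) - a).natAbs : ℕ) : ℝ) / Nat.totient (((h : ℤ) - a).natAbs))
          + ((X : ℝ)) ^ (3 / 4 : ℝ)) := Finset.sum_le_sum fun h hh => hExc_h j hj h hh
      _ = ∑ h ∈ Hg, (CE * (X * SA * (Real.log (P j) / Real.log (Q j))) *
            ∏ a ∈ A, (((((h : ℤ) - a).natAbs : ℕ) : ℝ) / Nat.totient (((h : ℤ) - a).natAbs)) +
            CE * ((X : ℝ)) ^ (3 / 4 : ℝ)) := Finset.sum_congr rfl fun h _ => by ring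
      _ = CE * (X * SA * (Real.log (P j) / Real.log (Q j))) *
            (∑ h ∈ Hg, ∏ a ∈ A, (((((h : ℤ) - a).natAbs : ℕ) : ℝ) /
              Nat.totient (((h : ℤ) - a).natAbs))) + #Hg * (CE * ((X : ℝ)) ^ (3 / 4 : ℝ)) := by
          rw [Finset.sum_add_distrib, Finset.sum_const, nsmul_eq_mul, Finset.mul_sum]
      _ ≤ CE * (X * SA * (Real.log (P j) / Real.log (Q j))) * (CW * (3 * H)) +
            H * (CE * ((X : ℝ)) ^ (3 / 4 : ℝ)) :=
          add_le_add (mul_le_mul_of_nonneg_left hWsum hc0)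
            (mul_le_mul_of_nonneg_right hHgcard (by positivity))
      _ = _ := by ring
  refine (Finset.sum_le_sum hjbound).trans ?_
  rw [Finset.sum_add_distrib, Finset.sum_const, nsmul_eq_mul, ← Finset.mul_sum, ← Finset.mul_sum]
  have hρs : 0 ≤ ∑ j ∈ JS, Real.log (P j) / Real.log (Q j) := by
    refine Finset.sum_nonneg fun j hj => ?_
    obtain ⟨hP2, hPQ', _⟩ := hPQ j hj
    exact div_nonneg (Real.log_nonneg (by linarith only [hP2]))
      (Real.log_nonneg (by linarith only [hP2, hPQ']))
  have h1 : 0 ≤ CE * ((X : ℝ) * H * ∑ j ∈ JS, Real.log (P j) / Real.log (Q j)) := by positivity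
  have h2 : 0 ≤ 3 * CE * SA * CW * (#JS * H * ((X : ℝ)) ^ (3 / 4 : ℝ)) := by positivity
  nlinarith only [h1, h2]

set_option maxHeartbeats 1600000 in
/-- **The main term of §4: Propositions 2.1 + 2.7 fed into Proposition 3.2.**  With
`A₂ = C_U (2H)² X₃/V`, `A₁ = B (log log X)^{C₀} (2H)^{2j−1} X₃`, `V = s^{2j+C₀}`, `log log X ≤ s`:
`∑_{h ≤ H} |∑_{n ≤ X} w(n) u(n+h)| ≤ (8^j C_U B)^{1/2j} · H X₃/s` (`holder_fourier_bound` and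
`main_term_algebra`). [cite: LichtmanTeravainen2022, Section 4, display (4.4)] -/
theorem main_sum_le (X H j C₀ : ℕ) (hH : 1 ≤ H) (hj : 2 ≤ j) (u w : ℕ → ℂ)
    (hw : ∀ n, n ∉ Icc 1 X → w n = 0) (hu1 : ∀ m, ‖u m‖ ≤ 1)
    {CU Bm s LL V : ℝ} (hCU : 0 ≤ CU) (hBm : 0 ≤ Bm) (hs : 0 < s) (hLL0 : 0 ≤ LL) (hLLs : LL ≤ s)
    (hV : V = s ^ (2 * j + C₀))
    (hA₂ : ∀ α : ℝ, ∑ k ∈ Icc 1 (X + 2 * H),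
      ‖∑ m ∈ Ioc (k - 2 * H) k, u m * (𝐞 ((m : ℝ) * α) : ℂ)‖ ^ 2 ≤
        CU * ((2 * H : ℕ) : ℝ) ^ 2 * ((X + 2 * H : ℕ) : ℝ) / V)
    (hA₁ : ∫ α in (0 : ℝ)..1, ∑ k ∈ Icc 1 (X + 2 * H),
      ‖∑ n ∈ Ioc (k - 2 * H) k, w n * (𝐞 (-((n : ℝ) * α)) : ℂ)‖ ^ (2 * j) ≤
        Bm * LL ^ C₀ * ((2 * H : ℕ) : ℝ) ^ (2 * j - 1) * ((X + 2 * H : ℕ) : ℝ)) :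
    ∑ h ∈ Icc 1 H, ‖∑ n ∈ Icc 1 X, w n * u (n + h)‖ ≤
      (2 ^ (3 * j) * CU * Bm) ^ (1 / ((2 * j : ℕ) : ℝ)) * (H * ((X + 2 * H : ℕ) : ℝ) / s) := by
  have hj1 : 1 ≤ j := by omega
  have hH0 : (0 : ℝ) < H := by exact_mod_cast hH
  have hLR : ((2 * H : ℕ) : ℝ) = 2 * (H : ℝ) := by push_cast; ring
  set X₃ : ℝ := ((X + 2 * H : ℕ) : ℝ) with hX₃
  have hX₃0 : 0 < X₃ := by rw [hX₃]; push_cast; linarith only [hH0, (Nat.cast_nonneg X : (0:ℝ) ≤ X)]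
  set Smain : ℝ := ∑ h ∈ Icc 1 H, ‖∑ n ∈ Icc 1 X, w n * u (n + h)‖ with hSmain
  have hSmain0 : 0 ≤ Smain := Finset.sum_nonneg fun h _ => norm_nonneg _
  have hholder := holder_fourier_bound X H j hH hj u w hw hA₂ hA₁
  -- `∑ |u|² ≤ X₃`
  have hBu : ∑ m ∈ Icc 1 (X + 2 * H), ‖u m‖ ^ 2 ≤ X₃ := by
    calc ∑ m ∈ Icc 1 (X + 2 * H), ‖u m‖ ^ 2 ≤ ∑ m ∈ Icc 1 (X + 2 * H), (1 : ℝ) :=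
          Finset.sum_le_sum fun m _ => by
            have h1 := hu1 m
            have h0 := norm_nonneg (u m)
            nlinarith only [h1, h0]
      _ = X₃ := by rw [Finset.sum_const, Nat.card_Icc, nsmul_eq_mul, mul_one, hX₃]; push_cast; simp
  have hθ0 : 0 ≤ ((j : ℝ) - 1) / (2 * j) := by
    have : (1 : ℝ) ≤ j := by exact_mod_cast hj1
    exact div_nonneg (by linarith only [this]) (by positivity)
  have halg_in : (H : ℝ) * Smain ≤ (CU * (2 * H) ^ 2 * X₃ / V) ^ (1 / (2 * j) : ℝ) * H ^ (1 / 2 : ℝ) *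
      ((2 * H) * X₃) ^ (((j : ℝ) - 1) / (2 * j)) *
      (X₃ ^ (j - 1) * (Bm * LL ^ C₀ * (2 * H) ^ (2 * j - 1) * X₃)) ^ (1 / (2 * j) : ℝ) := by
    refine hholder.trans ?_
    rw [hLR]
    have hmono : ((2 * H : ℝ) * ∑ m ∈ Icc 1 (X + 2 * H), ‖u m‖ ^ 2) ^ (((j : ℝ) - 1) / (2 * j)) ≤
        ((2 * H) * X₃) ^ (((j : ℝ) - 1) / (2 * j)) :=
      Real.rpow_le_rpow (by positivity) (mul_le_mul_of_nonneg_left hBu (by positivity)) hθ0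
    have hV0 : 0 ≤ V := by rw [hV]; positivity
    have h1 : 0 ≤ (CU * (2 * (H : ℝ)) ^ 2 * X₃ / V) ^ (1 / (2 * j) : ℝ) * (H : ℝ) ^ (1 / 2 : ℝ) := by
      positivity
    have h2 : 0 ≤ (X₃ ^ (j - 1) * (Bm * LL ^ C₀ * (2 * (H : ℝ)) ^ (2 * j - 1) * X₃)) ^ (1 / (2 * j) : ℝ) := by
      positivity
    exact mul_le_mul_of_nonneg_right (mul_le_mul_of_nonneg_left hmono h1) h2
  exact main_term_algebra hj1 hSmain0 hH0 hX₃0 hs hLL0 hLLs hCU hBm hV halg_in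

set_option maxHeartbeats 4000000 in
/-- **Lichtman–Teräväinen 2022, §4 (proof of Theorem 1.6 ⇒ Theorem 1.2 (i)), for a real
`1`-bounded function `f` in place of `μ`**, given (I) the `𝖧₂`-input for `f 1_𝒮` in the form of
`moebius_typ_window_sq_le` (hypothesis `hU`) and (II) the moment bound of Proposition 2.7 in the
form of hypothesis `𝖧₁` of `holder_fourier_bound` (hypothesis `hM`, any power of `log log X` being
allowed in the constant): for `(log X)^{#A+ε} ≤ H ≤ exp((log X)^a)`,
`∑_{h ≤ H} |∑_{n ≤ X} ∏_{a∈A} Λ(n+a) ∏_{b ∈ {h} ∪ B'} f(n+b)| ≤ C H X (log log H)/log H`.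
The proof is the printed one: split `f(n+h) = (f1_𝒮)(n+h) + (f1_{𝒮ᶜ})(n+h)`; the second part is
`≤ ∑_j ∑_h ∑_n 1[n+h ∉ 𝒮_j] ∏Λ(n+a) ≪ X (log P₁/log Q₁) ∑_h ∏ |h−a|/φ ≪ δ' XH`
(`exceptional_sum_le`, `sum_log_seqP_div_log_seqQ_le`, `pq_facts`); the first is
`≪ (η B)^{1/2j} H X` by Proposition 3.2 (`main_sum_le`) with `η = C/V`, `V = (log H)^{2j+C₀}`
(`hlc_params`); the `O(1)` shifts `h ∈ A ∪ B'` are bounded by Lemma 2.3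
(`sum_prod_vonMangoldt_le_linear`).  The exponent is `a = 1/(625(2j + C₀))`.
[cite: LichtmanTeravainen2022, Section 4, proof of Theorem 1.6 and Remark 1.7] -/
theorem hlc_avg_core (f : ℕ → ℝ) (fc : ArithmeticFunction ℂ)
    (hf1 : ∀ n, |f n| ≤ 1) (hfc : ∀ n, fc n = (f n : ℂ))
    (hU : ∃ C Cf V₀ X₀ : ℝ, 0 < C ∧ ∀ (X H : ℕ) (V α : ℝ),
      X₀ ≤ (X : ℝ) → V₀ ≤ V → 1 ≤ H →
      V ^ 5 ≤ Real.log X ^ (1 / 125 : ℝ) → V ^ 1015 ≤ ((2 * H : ℕ) : ℝ) →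
      ((2 * H : ℕ) : ℝ) * V ^ 75 ≤ X → Real.log ((2 * H : ℕ) : ℝ) ≤ V →
      15 * Real.log V ≤ (1 / 4) * Real.log (Real.log X) - Cf →
      ∑ k ∈ Icc 1 (X + 2 * H), ‖∑ m ∈ Ioc (k - 2 * H) k,
          typFun (⇑fc) ((V ^ 5) ^ 200) (((2 * H : ℕ) : ℝ) / (V ^ 5) ^ 3)
            (Real.sqrt ((X + 2 * H : ℕ) : ℝ)) ((X + 2 * H : ℕ) : ℝ) m * (𝐞 ((m : ℝ) * α) : ℂ)‖ ^ 2 ≤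
        C * ((2 * H : ℕ) : ℝ) ^ 2 * ((X + 2 * H : ℕ) : ℝ) / V)
    (hM : ∀ (A : Finset ℕ) (ε : ℝ), 0 < ε → (∀ a ∈ A, 1 ≤ a) →
      ∃ (j C₀ : ℕ) (B X₁ : ℝ), 2 ≤ j ∧ ∀ (X H : ℕ), X₁ ≤ (X : ℝ) →
        Real.log X ^ ((#A : ℝ) + ε) ≤ H → (H : ℝ) ≤ X → ∀ b : ℕ → ℂ, (∀ n, ‖b n‖ ≤ 1) →
        ∫ α in (0 : ℝ)..1, ∑ k ∈ Icc 1 (X + 2 * H),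
          ‖∑ n ∈ Ioc (k - 2 * H) k,
            (if n ∈ Icc 1 X then b n * ∏ a ∈ A, (Λ (n + a) : ℂ) else 0) *
              (𝐞 (-((n : ℝ) * α)) : ℂ)‖ ^ (2 * j) ≤
          B * Real.log (Real.log X) ^ C₀ * ((2 * H : ℕ) : ℝ) ^ (2 * j - 1) * ((X + 2 * H : ℕ) : ℝ)) :
    ∀ ε : ℝ, 0 < ε → ∀ A B' : Finset ℕ, A.Nonempty → Disjoint A B' → (∀ s ∈ A ∪ B', 1 ≤ s) →
    ∃ a : ℝ, 0 < a ∧ ∃ C X₀ : ℝ, ∀ X : ℕ, X₀ ≤ X → ∀ H : ℕ,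
      Real.log X ^ ((#A : ℝ) + ε) ≤ H → (H : ℝ) ≤ Real.exp (Real.log X ^ a) →
        ∑ h ∈ Icc 1 H, |∑ n ∈ Icc 1 X, (∏ a ∈ A, Λ (n + a)) * ∏ b ∈ insert h B', f (n + b)| ≤
          C * H * X * Real.log (Real.log H) / Real.log H := by
  intro ε hε A B' hAne hAB hpos1
  have hA1 : ∀ a ∈ A, 1 ≤ a := fun a ha => hpos1 a (Finset.mem_union_left _ ha)
  have hℓpos : 0 < #A := Finset.card_pos.mpr hAne
  have hℓ1 : (1 : ℝ) ≤ #A := by exact_mod_cast hℓpos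
  -- the constants
  obtain ⟨j, C₀, B, X₁, hj2, hMom⟩ := hM A ε hε hA1
  obtain ⟨CU, Cf, V₀, XU, hCU, hUse⟩ := hU
  obtain ⟨CX, hCX, hExcS⟩ := exceptional_sum_le A B' hAne
  obtain ⟨CA, hCA, hLin⟩ := sum_prod_vonMangoldt_le_linear A
  have hj1 : 1 ≤ j := by omega
  set p₀ : ℕ := 2 * j + C₀ with hp₀
  have hp₀2 : 2 ≤ p₀ := by omega
  have hp₀R : (2 : ℝ) ≤ p₀ := by exact_mod_cast hp₀2
  set D : ℕ := A.sup id with hD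
  have hAD : ∀ x ∈ A, x ≤ D := fun x hx => Finset.le_sup (f := id) hx
  obtain ⟨T, hT64, hTD, hpar⟩ := hlc_params p₀ hp₀2 Cf V₀ D
  set Bm : ℝ := max B 0 with hBm
  have hBm0 : 0 ≤ Bm := le_max_right _ _
  set K : ℝ := (2 ^ (3 * j) * CU * Bm) ^ (1 / ((2 * j : ℕ) : ℝ)) with hK
  have hK0 : 0 ≤ K := by rw [hK]; positivity
  set Cfin : ℝ := 3 * K + 4000 * p₀ * CX + CX + (#A + #B') * CA with hCfin
  refine ⟨1 / (625 * (p₀ : ℝ)), by positivity, Cfin, max (max XU X₁) (Real.exp T), ?_⟩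
  intro X hX H hHlow hHup
  /- ───── Step 0: parameters ───── -/
  have hXU : XU ≤ X := le_trans (le_trans (le_max_left _ _) (le_max_left _ _)) hX
  have hX₁ : X₁ ≤ X := le_trans (le_trans (le_max_right _ _) (le_max_left _ _)) hX
  have hXT : Real.exp T ≤ X := le_trans (le_max_right _ _) hX
  have hκ : (1 : ℝ) ≤ (#A : ℝ) + ε := by linarith only [hℓ1, hε]
  obtain ⟨ht0, hHT, hs4, hts, hst, hlogs1, h2H2, hV₀, hV4, hc1, hc2, hc3, hc4, hc5, h30, hjunk⟩ :=
    hpar X H ((#A : ℝ) + ε) hκ hXT hHlow hHup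
  set t : ℝ := Real.log X with ht
  set s : ℝ := Real.log H with hs
  set V : ℝ := s ^ p₀ with hV
  have hX0 : (0 : ℝ) < X := lt_of_lt_of_le (Real.exp_pos T) hXT
  have hH1 : (1 : ℝ) ≤ H := by linarith only [hT64, hHT]
  have hH0 : (0 : ℝ) < H := by linarith only [hH1]
  have hHnat : 1 ≤ H := by exact_mod_cast hH1
  have hs1 : 1 ≤ s := by linarith only [hs4]
  have hs0 : 0 < s := by linarith only [hs1]
  have hlogt0 : 0 ≤ Real.log t := by
    have : 1 ≤ t := by
      have h1 : T ≤ t := by rw [ht, ← Real.log_exp T]; exact Real.log_le_log (Real.exp_pos T) hXT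
      linarith only [h1, hT64]
    exact Real.log_nonneg this
  have h2HX : 2 * (H : ℝ) ≤ X := by nlinarith only [h2H2, hH1]
  have hHX : (H : ℝ) ≤ X := by linarith only [h2HX, hH0]
  have hLR : ((2 * H : ℕ) : ℝ) = 2 * (H : ℝ) := by push_cast; ring
  set X₃ : ℝ := ((X + 2 * H : ℕ) : ℝ) with hX₃
  have hX₃eq : X₃ = (X : ℝ) + 2 * H := by rw [hX₃]; push_cast; ring
  have hX₃3 : X₃ ≤ 3 * X := by rw [hX₃eq]; linarith only [h2HX]
  have hX₃0 : 0 < X₃ := by rw [hX₃eq]; linarith only [hX0, hH0]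
  have hX3 : (3 : ℝ) ≤ X := by linarith only [hHX, hHT, hT64]
  have hX₃sq : X₃ ≤ (X : ℝ) ^ 2 := by rw [hX₃eq]; nlinarith only [h2HX, hX3]
  have hfloorX₃ : ⌊X₃⌋₊ = X + 2 * H := by rw [hX₃, Nat.floor_natCast]
  -- `P₁`, `Q₁`
  set P₁ : ℝ := (V ^ 5) ^ 200 with hP₁
  set Q₁ : ℝ := ((2 * H : ℕ) : ℝ) / (V ^ 5) ^ 3 with hQ₁
  have hsL : s ≤ Real.log ((2 * H : ℕ) : ℝ) := by
    rw [hLR, Real.log_mul (by norm_num) hH0.ne', ← hs]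
    have : 0 ≤ Real.log 2 := Real.log_nonneg (by norm_num)
    linarith only [this]
  obtain ⟨hP₁2, hP₁Q₁, hQ₁0, hlogP₁0, hlogQ₁, hρ₁⟩ :=
    pq_facts p₀ hs4 hV hV4 (by rw [hLR]; positivity) hc2 hsL h30
  have hP₁1 : 1 < P₁ := by linarith only [hP₁2]
  have hlogQ₁0 : 0 < Real.log Q₁ := by linarith only [hlogQ₁]
  have hlogPQ : Real.log P₁ ≤ Real.log Q₁ := Real.log_le_log (by linarith only [hP₁2]) hP₁Q₁
  -- the intervals `[P_j, Q_j]`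
  have hsqrtX₃ : Real.log (Real.sqrt X₃) ≤ t := by
    rw [Real.log_sqrt hX₃0.le]
    have : Real.log X₃ ≤ Real.log ((X : ℝ) ^ 2) := Real.log_le_log hX₃0 hX₃sq
    rw [Real.log_pow] at this
    push_cast at this
    rw [← ht] at this
    linarith only [this]
  have ht12 : t ^ (1 / 2 : ℝ) * t ^ (1 / 2 : ℝ) = t := by rw [← Real.rpow_add ht0]; norm_num
  have ht4 : 4 ≤ t ^ (1 / 2 : ℝ) := by
    have ht16 : 16 ≤ t := by
      have h1 : T ≤ t := by rw [ht, ← Real.log_exp T]; exact Real.log_le_log (Real.exp_pos T) hXT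
      linarith only [h1, hT64]
    have h1 : (16 : ℝ) ^ (1 / 2 : ℝ) ≤ t ^ (1 / 2 : ℝ) := Real.rpow_le_rpow (by norm_num) ht16 (by norm_num)
    have h16 : (16 : ℝ) ^ (1 / 2 : ℝ) = 4 := by
      rw [show (16 : ℝ) = 4 ^ (2 : ℝ) by norm_num, ← Real.rpow_mul (by norm_num)]; norm_num
    rwa [h16] at h1
  have hJ_le : Real.sqrt (Real.log (Real.sqrt X₃)) ≤ t / 4 := by
    have h0 : 0 ≤ t ^ (1 / 2 : ℝ) := Real.rpow_nonneg ht0.le _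
    calc Real.sqrt (Real.log (Real.sqrt X₃)) ≤ Real.sqrt t := Real.sqrt_le_sqrt hsqrtX₃
      _ = t ^ (1 / 2 : ℝ) := Real.sqrt_eq_rpow t
      _ ≤ t / 4 := by
          have := mul_le_mul_of_nonneg_right ht4 h0
          linarith only [this, ht12]
  have hX14 : Real.exp (t / 4) = (X : ℝ) ^ (1 / 4 : ℝ) := by
    rw [Real.rpow_def_of_pos hX0, ← ht]; ring_nf
  have hQj_le : Real.exp (Real.sqrt (Real.log (Real.sqrt X₃))) ≤ (X : ℝ) ^ (1 / 4 : ℝ) := by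
    rw [← hX14]; exact Real.exp_le_exp.mpr hJ_le
  set JS : Finset ℕ := (Icc 1 ⌊Real.sqrt (Real.log (Real.sqrt X₃))⌋₊).filter
    (fun j' => seqQ Q₁ j' ≤ Real.exp (Real.sqrt (Real.log (Real.sqrt X₃)))) with hJS
  have hJS1 : ∀ j' ∈ JS, 1 ≤ j' := fun j' hj' =>
    (Finset.mem_Icc.mp (Finset.mem_filter.mp hj').1).1
  have hJScard : (#JS : ℝ) ≤ t := by
    calc (#JS : ℝ) ≤ #(Icc 1 ⌊Real.sqrt (Real.log (Real.sqrt X₃))⌋₊) := by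
          exact_mod_cast Finset.card_le_card (Finset.filter_subset _ _)
      _ = ⌊Real.sqrt (Real.log (Real.sqrt X₃))⌋₊ := by rw [Nat.card_Icc]; push_cast; simp
      _ ≤ Real.sqrt (Real.log (Real.sqrt X₃)) := Nat.floor_le (Real.sqrt_nonneg _)
      _ ≤ t / 4 := hJ_le
      _ ≤ t := by linarith only [ht0]
  have hPQj : ∀ j' ∈ JS, 2 ≤ seqP P₁ Q₁ j' ∧ seqP P₁ Q₁ j' ≤ seqQ Q₁ j' ∧
      seqQ Q₁ j' ≤ (X : ℝ) ^ (1 / 4 : ℝ) := by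
    intro j' hj'
    have hmem := Finset.mem_filter.mp hj'
    exact ⟨hP₁2.trans (le_seqP hP₁1 hlogQ₁), seqP_le_seqQ (hJS1 j' hj') hlogP₁0 hlogPQ hP₁Q₁,
      hmem.2.trans hQj_le⟩
  have hsumρ : ∑ j' ∈ JS, Real.log (seqP P₁ Q₁ j') / Real.log (seqQ Q₁ j') ≤
      4000 * p₀ * (Real.log s / s) := by
    have h1 := sum_log_seqP_div_log_seqQ_le hlogP₁0 hlogQ₁0 JS hJS1
    have h2 := mul_le_mul_of_nonneg_left hρ₁ (by norm_num : (0 : ℝ) ≤ 2)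
    linarith only [h1, h2]
  /- ───── Step 1: the functions and the pointwise decomposition ───── -/
  have hfc1 : ∀ n, ‖fc n‖ ≤ 1 := fun n => by
    rw [hfc, Complex.norm_real, Real.norm_eq_abs]; exact hf1 n
  set F : ℕ → ℝ := fun n => ∏ a ∈ A, Λ (n + a) with hF
  have hF0 : ∀ n, 0 ≤ F n := fun n => Finset.prod_nonneg fun a _ => ArithmeticFunction.vonMangoldt_nonneg
  set Mb : ℕ → ℝ := fun n => ∏ b ∈ B', f (n + b) with hMb
  have hMb1 : ∀ n, |Mb n| ≤ 1 := fun n => by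
    rw [hMb, Finset.abs_prod]
    exact Finset.prod_le_one (fun b _ => abs_nonneg _) fun b _ => hf1 _
  set b : ℕ → ℂ := fun n => (Mb n : ℂ) with hb
  have hb1 : ∀ n, ‖b n‖ ≤ 1 := fun n => by
    rw [hb, Complex.norm_real, Real.norm_eq_abs]; exact hMb1 n
  set w : ℕ → ℂ := fun n => if n ∈ Icc 1 X then b n * ∏ a ∈ A, (Λ (n + a) : ℂ) else 0 with hw
  have hw0 : ∀ n, n ∉ Icc 1 X → w n = 0 := fun n hn => by simp only [hw]; rw [if_neg hn]
  have hFc : ∀ n, (∏ a ∈ A, (Λ (n + a) : ℂ)) = ((F n : ℝ) : ℂ) := fun n => by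
    rw [hF]; push_cast; rfl
  have hwF : ∀ n, ‖w n‖ ≤ F n := fun n => by
    simp only [hw]
    split_ifs
    · rw [norm_mul, hFc, Complex.norm_real (F n), Real.norm_eq_abs, abs_of_nonneg (hF0 n)]
      exact mul_le_of_le_one_left (hF0 n) (hb1 n)
    · rw [norm_zero]; exact hF0 n
  set u : ℕ → ℂ := typFun (⇑fc) P₁ Q₁ (Real.sqrt X₃) X₃ with hu
  have hu1 : ∀ m, ‖u m‖ ≤ 1 := fun m => norm_typFun_le hfc1 _ _ _ _ m
  set ind : ℕ → ℝ := fun m => ∑ j' ∈ JS,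
    (if HasFactorIn m (seqP P₁ Q₁ j') (seqQ Q₁ j') then (0 : ℝ) else 1) with hind
  -- `|f(m) − u(m)| ≤ ind(m)` on `[1, X₃]`
  have hfu : ∀ m ∈ Icc 1 (X + 2 * H), ‖(f m : ℂ) - u m‖ ≤ ind m := by
    intro m hm
    have hm' : m ∈ Icc 1 ⌊X₃⌋₊ := by rwa [hfloorX₃]
    have h1 := indicator_not_typical_le (P₁ := P₁) (X₀ := Real.sqrt X₃) hQ₁0 hlogQ₁ hm'
    refine le_trans ?_ h1
    simp only [hu, typFun]
    split_ifs with hS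
    · rw [hfc, sub_self, norm_zero]
    · rw [sub_zero, Complex.norm_real, Real.norm_eq_abs]; exact hf1 m
  -- the correlation for `h ∉ B'`
  have hcorr : ∀ h, h ∉ B' →
      ((∑ n ∈ Icc 1 X, F n * ∏ b ∈ insert h B', f (n + b) : ℝ) : ℂ) =
        ∑ n ∈ Icc 1 X, w n * (f (n + h) : ℂ) := by
    intro h hh
    push_cast
    refine Finset.sum_congr rfl fun n hn => ?_
    simp only [hw, hb, hMb]
    rw [if_pos hn, Finset.prod_insert hh, hFc]
    push_cast
    ring
  have hdecomp : ∀ h ∈ Icc 1 H, h ∉ B' →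
      |∑ n ∈ Icc 1 X, F n * ∏ b ∈ insert h B', f (n + b)| ≤
        ‖∑ n ∈ Icc 1 X, w n * u (n + h)‖ + ∑ n ∈ Icc 1 X, F n * ind (n + h) := by
    intro h hh hhB
    have hhH := Finset.mem_Icc.mp hh
    rw [← Real.norm_eq_abs, ← Complex.norm_real, hcorr h hhB]
    have hsplit : ∑ n ∈ Icc 1 X, w n * (f (n + h) : ℂ) =
        ∑ n ∈ Icc 1 X, w n * u (n + h) + ∑ n ∈ Icc 1 X, w n * ((f (n + h) : ℂ) - u (n + h)) := by
      rw [← Finset.sum_add_distrib]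
      exact Finset.sum_congr rfl fun n _ => by ring
    rw [hsplit]
    refine (norm_add_le _ _).trans (add_le_add le_rfl ?_)
    refine (norm_sum_le _ _).trans (Finset.sum_le_sum fun n hn => ?_)
    have hnX := Finset.mem_Icc.mp hn
    rw [norm_mul]
    refine mul_le_mul (hwF n) (hfu (n + h) ?_) (norm_nonneg _) (hF0 n)
    rw [Finset.mem_Icc]; omega
  /- ───── Step 2: the `O(1)` shifts `h ∈ A ∪ B'` ───── -/
  have hAX : ∀ x ∈ A, x ≤ X := by
    intro x hx
    have h1 : (x : ℝ) ≤ D := by exact_mod_cast hAD x hx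
    have h2 : (x : ℝ) ≤ X := by linarith only [h1, hTD, hHT, hHX]
    exact_mod_cast h2
  have hAH : ∀ x ∈ A, (x : ℝ) + 1 ≤ H := by
    intro x hx
    have h1 : (x : ℝ) ≤ D := by exact_mod_cast hAD x hx
    linarith only [h1, hTD, hHT]
  have hcoll : ∀ h, |∑ n ∈ Icc 1 X, F n * ∏ b ∈ insert h B', f (n + b)| ≤ CA * X := fun h =>
    (abs_corr_le_sum_prod f hf1 A (insert h B') X).trans (hLin X hAX)
  set Hg : Finset ℕ := (Icc 1 H).filter (fun h => h ∉ A ∪ B') with hHg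
  set Hb : Finset ℕ := (Icc 1 H).filter (fun h => ¬ (h ∉ A ∪ B')) with hHb
  have hsplitH := (Finset.sum_filter_add_sum_filter_not (Icc 1 H) (fun h => h ∉ A ∪ B')
    (fun h => |∑ n ∈ Icc 1 X, F n * ∏ b ∈ insert h B', f (n + b)|)).symm
  have hHbcard : (#Hb : ℝ) ≤ #A + #B' := by
    have h1 : Hb ⊆ A ∪ B' := by
      intro h hh
      have := (Finset.mem_filter.mp hh).2
      push Not at this
      exact this
    calc (#Hb : ℝ) ≤ #(A ∪ B') := by exact_mod_cast Finset.card_le_card h1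
      _ ≤ #A + #B' := by exact_mod_cast Finset.card_union_le A B'
  have hSbad : ∑ h ∈ Hb, |∑ n ∈ Icc 1 X, F n * ∏ b ∈ insert h B', f (n + b)| ≤
      (#A + #B') * CA * X := by
    calc ∑ h ∈ Hb, |∑ n ∈ Icc 1 X, F n * ∏ b ∈ insert h B', f (n + b)|
        ≤ ∑ h ∈ Hb, CA * X := Finset.sum_le_sum fun h _ => hcoll h
      _ = #Hb * (CA * X) := by rw [Finset.sum_const, nsmul_eq_mul]
      _ ≤ (#A + #B') * (CA * X) := mul_le_mul_of_nonneg_right hHbcard (by positivity)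
      _ = (#A + #B') * CA * X := by ring
  /- ───── Step 3: the exceptional set ───── -/
  have hSexc : ∑ h ∈ Hg, ∑ n ∈ Icc 1 X, F n * ind (n + h) ≤
      4000 * p₀ * CX * (H * X * (Real.log s / s)) + CX * (t * H * ((X : ℝ)) ^ (3 / 4 : ℝ)) := by
    have h1 := hExcS X H JS (fun j' => seqP P₁ Q₁ j') (fun j' => seqQ Q₁ j') hAX hAH hPQj
    refine h1.trans ?_
    have h2 : (X : ℝ) * H * ∑ j' ∈ JS, Real.log (seqP P₁ Q₁ j') / Real.log (seqQ Q₁ j') ≤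
        (X : ℝ) * H * (4000 * p₀ * (Real.log s / s)) :=
      mul_le_mul_of_nonneg_left hsumρ (by positivity)
    have h3 : (#JS : ℝ) * H * ((X : ℝ)) ^ (3 / 4 : ℝ) ≤ t * H * ((X : ℝ)) ^ (3 / 4 : ℝ) := by
      have : 0 ≤ (H : ℝ) * ((X : ℝ)) ^ (3 / 4 : ℝ) := by positivity
      nlinarith only [hJScard, this]
    have h4 := add_le_add h2 h3
    calc CX * ((X : ℝ) * H * ∑ j' ∈ JS, Real.log (seqP P₁ Q₁ j') / Real.log (seqQ Q₁ j') +
          #JS * H * ((X : ℝ)) ^ (3 / 4 : ℝ))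
        ≤ CX * ((X : ℝ) * H * (4000 * p₀ * (Real.log s / s)) + t * H * ((X : ℝ)) ^ (3 / 4 : ℝ)) :=
          mul_le_mul_of_nonneg_left h4 hCX.le
      _ = _ := by ring
  -- `t H X^{3/4} ≤ H X log s / s`
  have hjunk' : t * H * ((X : ℝ)) ^ (3 / 4 : ℝ) ≤ H * X * (Real.log s / s) := by
    have hXsplit : (X : ℝ) ^ (1 / 4 : ℝ) * ((X : ℝ)) ^ (3 / 4 : ℝ) = X := by
      rw [← Real.rpow_add hX0]; norm_num
    have hX34 : 0 ≤ ((X : ℝ)) ^ (3 / 4 : ℝ) := by positivity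
    rw [mul_div_assoc', le_div_iff₀ hs0]
    have h1 : (t * s) * ((X : ℝ)) ^ (3 / 4 : ℝ) ≤ (X : ℝ) ^ (1 / 4 : ℝ) * ((X : ℝ)) ^ (3 / 4 : ℝ) :=
      mul_le_mul_of_nonneg_right hjunk hX34
    rw [hXsplit] at h1
    have h2 : (H : ℝ) * X * 1 ≤ H * X * Real.log s :=
      mul_le_mul_of_nonneg_left hlogs1 (by positivity)
    have h3 := mul_le_mul_of_nonneg_left h1 hH0.le
    calc t * H * ((X : ℝ)) ^ (3 / 4 : ℝ) * s = H * ((t * s) * ((X : ℝ)) ^ (3 / 4 : ℝ)) := by ring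
      _ ≤ H * X := h3
      _ ≤ H * X * Real.log s := by linarith only [h2]
  /- ───── Step 4: the main term ───── -/
  set A₂ : ℝ := CU * ((2 * H : ℕ) : ℝ) ^ 2 * X₃ / V with hA₂
  have hA₂' : ∀ α : ℝ, ∑ k ∈ Icc 1 (X + 2 * H),
      ‖∑ m ∈ Ioc (k - 2 * H) k, u m * (𝐞 ((m : ℝ) * α) : ℂ)‖ ^ 2 ≤ A₂ :=
    fun α => hUse X H V α hXU hV₀ hHnat hc1 hc2 hc3 hc4 hc5
  set LL : ℝ := Real.log (Real.log X) with hLL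
  have hLL0 : 0 ≤ LL := by rw [hLL, ← ht]; exact hlogt0
  have hLLs : LL ≤ s := by rw [hLL, ← ht]; exact hts
  set A₁ : ℝ := Bm * LL ^ C₀ * ((2 * H : ℕ) : ℝ) ^ (2 * j - 1) * X₃ with hA₁
  have hA₁' : ∫ α in (0 : ℝ)..1, ∑ k ∈ Icc 1 (X + 2 * H),
      ‖∑ n ∈ Ioc (k - 2 * H) k, w n * (𝐞 (-((n : ℝ) * α)) : ℂ)‖ ^ (2 * j) ≤ A₁ := by
    have h1 := hMom X H hX₁ hHlow hHX b hb1
    refine h1.trans ?_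
    rw [hA₁]
    have : 0 ≤ LL ^ C₀ * ((2 * H : ℕ) : ℝ) ^ (2 * j - 1) * X₃ := by positivity
    calc B * Real.log (Real.log X) ^ C₀ * ((2 * H : ℕ) : ℝ) ^ (2 * j - 1) * X₃
        = B * (LL ^ C₀ * ((2 * H : ℕ) : ℝ) ^ (2 * j - 1) * X₃) := by rw [hLL]; ring
      _ ≤ Bm * (LL ^ C₀ * ((2 * H : ℕ) : ℝ) ^ (2 * j - 1) * X₃) :=
          mul_le_mul_of_nonneg_right (le_max_left _ _) this
      _ = _ := by ring
  have hVeq : V = s ^ (2 * j + C₀) := by rw [hV, hp₀]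
  have hmain := main_sum_le X H j C₀ hHnat hj2 u w hw0 hu1 hCU.le hBm0 hs0 hLL0 hLLs hVeq hA₂' hA₁'
  have hSmain : ∑ h ∈ Icc 1 H, ‖∑ n ∈ Icc 1 X, w n * u (n + h)‖ ≤ 3 * K * (H * X * (Real.log s / s)) := by
    refine hmain.trans ?_
    rw [← hK, ← hX₃]
    have h1 : (H : ℝ) * X₃ / s ≤ 3 * (H * X * (Real.log s / s)) := by
      rw [div_le_iff₀ hs0]
      have e : 3 * ((H : ℝ) * X * (Real.log s / s)) * s = 3 * (H * X) * Real.log s := by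
        field_simp
      rw [e]
      calc (H : ℝ) * X₃ ≤ H * (3 * X) := mul_le_mul_of_nonneg_left hX₃3 hH0.le
        _ = 3 * (H * X) * 1 := by ring
        _ ≤ 3 * (H * X) * Real.log s := mul_le_mul_of_nonneg_left hlogs1 (by positivity)
    calc K * (H * X₃ / s) ≤ K * (3 * (H * X * (Real.log s / s))) := mul_le_mul_of_nonneg_left h1 hK0
      _ = _ := by ring
  /- ───── Step 5: assembly ───── -/
  have hSgood : ∑ h ∈ Hg, |∑ n ∈ Icc 1 X, F n * ∏ b ∈ insert h B', f (n + b)| ≤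
      ∑ h ∈ Icc 1 H, ‖∑ n ∈ Icc 1 X, w n * u (n + h)‖ + ∑ h ∈ Hg, ∑ n ∈ Icc 1 X, F n * ind (n + h) := by
    have h1 : ∀ h ∈ Hg, |∑ n ∈ Icc 1 X, F n * ∏ b ∈ insert h B', f (n + b)| ≤
        ‖∑ n ∈ Icc 1 X, w n * u (n + h)‖ + ∑ n ∈ Icc 1 X, F n * ind (n + h) := by
      intro h hh
      have := Finset.mem_filter.mp hh
      exact hdecomp h this.1 fun h' => this.2 (Finset.mem_union_right _ h')
    refine (Finset.sum_le_sum h1).trans ?_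
    rw [Finset.sum_add_distrib]
    refine add_le_add ?_ le_rfl
    exact Finset.sum_le_sum_of_subset_of_nonneg (Finset.filter_subset _ _) fun h _ _ => norm_nonneg _
  have hcollfin : (#A + #B') * CA * X ≤ (#A + #B') * CA * (H * X * (Real.log s / s)) := by
    refine mul_le_mul_of_nonneg_left ?_ (by positivity)
    have hsH : s ≤ H := by
      have := Real.log_le_sub_one_of_pos hH0; rw [← hs] at this; linarith only [this]
    rw [mul_div_assoc', le_div_iff₀ hs0]
    calc (X : ℝ) * s ≤ X * H := mul_le_mul_of_nonneg_left hsH hX0.le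
      _ = H * X * 1 := by ring
      _ ≤ H * X * Real.log s := mul_le_mul_of_nonneg_left hlogs1 (by positivity)
  have hHXL0 : 0 ≤ (H : ℝ) * X * (Real.log s / s) := by positivity
  have hCX2 := mul_le_mul_of_nonneg_left hjunk' hCX.le
  calc ∑ h ∈ Icc 1 H, |∑ n ∈ Icc 1 X, F n * ∏ b ∈ insert h B', f (n + b)|
      = ∑ h ∈ Hg, |∑ n ∈ Icc 1 X, F n * ∏ b ∈ insert h B', f (n + b)| +
          ∑ h ∈ Hb, |∑ n ∈ Icc 1 X, F n * ∏ b ∈ insert h B', f (n + b)| := hsplitH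
    _ ≤ (∑ h ∈ Icc 1 H, ‖∑ n ∈ Icc 1 X, w n * u (n + h)‖ +
          ∑ h ∈ Hg, ∑ n ∈ Icc 1 X, F n * ind (n + h)) + (#A + #B') * CA * X :=
        add_le_add hSgood hSbad
    _ ≤ (3 * K * (H * X * (Real.log s / s)) +
          (4000 * p₀ * CX * (H * X * (Real.log s / s)) + CX * (t * H * ((X : ℝ)) ^ (3 / 4 : ℝ)))) +
          (#A + #B') * CA * (H * X * (Real.log s / s)) :=
        add_le_add (add_le_add hSmain hSexc) hcollfin
    _ ≤ (3 * K * (H * X * (Real.log s / s)) +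
          (4000 * p₀ * CX * (H * X * (Real.log s / s)) + CX * (H * X * (Real.log s / s)))) +
          (#A + #B') * CA * (H * X * (Real.log s / s)) := by linarith only [hCX2]
    _ = Cfin * (H * X * (Real.log s / s)) := by rw [hCfin]; ring
    _ = Cfin * H * X * Real.log (Real.log H) / Real.log H := by rw [← hs]; ring

/-! ### The `𝖧₂` input for the Liouville function -/

/-- **Non-pretentiousness of `λ` (Vinogradov–Korobov)**: `M(λ; X, Q) ≥ ¼ log log X − C` for
`X ≥ X₀`, `1 ≤ Q ≤ (log X)^{1/125}` (the tree's (1.12),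
`MatomakiRadziwillTao2015_liouvilleDistLowerBound_holds`, `ε = 1/12`).
[cite: LichtmanTeravainen2022, Remark 1.7, display (1.4)] -/
theorem liouville_nonpretentiousness_ge : ∃ C X₀ : ℝ, ∀ X : ℝ, X₀ ≤ X → ∀ Q : ℝ, 1 ≤ Q →
    Q ≤ Real.log X ^ (1 / 125 : ℝ) →
    (1 / 4) * Real.log (Real.log X) - C ≤
      Sieve.nonpretentiousness (⇑(ArithmeticFunction.liouville : ArithmeticFunction ℂ)) X Q := by
  obtain ⟨C, X₀, h⟩ :=
    MatomakiRadziwillTao2015_liouvilleDistLowerBound_holds.pretentiousDistSq_ge (1 / 12) (by norm_num)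
  refine ⟨C, max X₀ 0, fun X hX Q hQ1 hQ => ?_⟩
  have hX0 : 0 ≤ X := le_trans (le_max_right _ _) hX
  have hXX₀ : X₀ ≤ X := le_trans (le_max_left _ _) hX
  refine Tao2016.le_nonpretentiousness hX0 hQ1 fun q χ t hq hqQ ht => ?_
  have := h X hXX₀ q χ t hq (hqQ.trans hQ) ht
  linarith

set_option maxHeartbeats 800000 in
/-- **The `𝖧₂` input for `f = λ`** (Proposition 2.1 / [MRT2015, Theorem 2.3] for the Liouville
function): the statement of `moebius_typ_window_sq_le` with `λ` in place of `μ`, by the same proof.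
[cite: LichtmanTeravainen2022, Proposition 2.1 and Remark 2.2]
[cite: MatomakiRadziwillTao2015, Theorem 2.3] -/
theorem liouville_typ_window_sq_le : ∃ C Cμ V₀ X₀ : ℝ, 0 < C ∧ ∀ (X H : ℕ) (V α : ℝ),
    X₀ ≤ (X : ℝ) → V₀ ≤ V → 1 ≤ H →
    V ^ 5 ≤ Real.log X ^ (1 / 125 : ℝ) → V ^ 1015 ≤ ((2 * H : ℕ) : ℝ) →
    ((2 * H : ℕ) : ℝ) * V ^ 75 ≤ X → Real.log ((2 * H : ℕ) : ℝ) ≤ V →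
    15 * Real.log V ≤ (1 / 4) * Real.log (Real.log X) - Cμ →
    ∑ k ∈ Icc 1 (X + 2 * H), ‖∑ m ∈ Ioc (k - 2 * H) k,
        typFun (⇑(ArithmeticFunction.liouville : ArithmeticFunction ℂ)) ((V ^ 5) ^ 200)
          (((2 * H : ℕ) : ℝ) / (V ^ 5) ^ 3) (Real.sqrt ((X + 2 * H : ℕ) : ℝ))
          ((X + 2 * H : ℕ) : ℝ) m * (𝐞 ((m : ℝ) * α) : ℂ)‖ ^ 2 ≤
      C * ((2 * H : ℕ) : ℝ) ^ 2 * ((X + 2 * H : ℕ) : ℝ) / V := by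
  obtain ⟨C, V₀, Xs, hC, hkey⟩ :=
    keyEstimate_typ (MatomakiRadziwillTao2015_theoremA2_of_propA3 MatomakiRadziwillTao2015_propA3_holds)
  obtain ⟨Cμ, X₀, hM⟩ := liouville_nonpretentiousness_ge
  refine ⟨C + 1, Cμ, max V₀ 1, max (max Xs X₀) (Real.exp 16), by positivity, ?_⟩
  intro X H V α hX hV hH hV5 hV1015 hLV hlogL hMV
  set μc : ArithmeticFunction ℂ := (ArithmeticFunction.liouville : ArithmeticFunction ℂ) with hμc
  have hμmult : μc.IsMultiplicative := isMultiplicative_liouville_complex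
  have hμ1 : ∀ n, ‖μc n‖ ≤ 1 := norm_liouville_complex_le_one
  -- parameters
  set L : ℕ := 2 * H with hL
  set X₃ : ℝ := ((X + 2 * H : ℕ) : ℝ) with hX₃
  have hXs : Xs ≤ X := le_trans (le_trans (le_max_left _ _) (le_max_left _ _)) hX
  have hX₀ : X₀ ≤ X := le_trans (le_trans (le_max_right _ _) (le_max_left _ _)) hX
  have hX16 : Real.exp 16 ≤ X := le_trans (le_max_right _ _) hX
  have hXpos : 0 < (X : ℝ) := lt_of_lt_of_le (Real.exp_pos _) hX16
  have hXX₃ : (X : ℝ) ≤ X₃ := by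
    rw [hX₃]; push_cast; linarith [(Nat.cast_nonneg H : (0:ℝ) ≤ H)]
  have hX₃pos : 0 < X₃ := lt_of_lt_of_le hXpos hXX₃
  have hV1 : 1 ≤ V := le_trans (le_max_right _ _) hV
  have hV₀ : V₀ ≤ V := le_trans (le_max_left _ _) hV
  have hlogX : 16 ≤ Real.log X := by
    rw [← Real.log_exp 16]; exact Real.log_le_log (Real.exp_pos _) hX16
  have hlogX₃ : Real.log X ≤ Real.log X₃ := Real.log_le_log hXpos hXX₃
  have hlogX₃16 : 16 ≤ Real.log X₃ := hlogX.trans hlogX₃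
  have hL1 : (1 : ℝ) ≤ (L : ℝ) := by rw [hL]; exact_mod_cast (show 1 ≤ 2 * H by omega)
  have hL0 : (0 : ℝ) < (L : ℝ) := by linarith
  have hV5' : V ^ 5 ≤ Real.log X₃ ^ (1 / 125 : ℝ) :=
    hV5.trans (Real.rpow_le_rpow (by linarith) hlogX₃ (by norm_num))
  have hLX₃ : (L : ℝ) * V ^ 75 ≤ X₃ := hLV.trans hXX₃
  have hLexp : (L : ℝ) ≤ Real.exp (Real.sqrt (Real.log X₃ / 2)) := by
    have h1 : Real.log L ≤ Real.log X₃ ^ (1 / 125 : ℝ) := by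
      calc Real.log L ≤ V := hlogL
        _ ≤ V ^ 5 := le_self_pow₀ hV1 (by norm_num)
        _ ≤ Real.log X₃ ^ (1 / 125 : ℝ) := hV5'
    have h2 := rpow_inv125_le_sqrt_half hlogX₃16
    calc (L : ℝ) = Real.exp (Real.log L) := (Real.exp_log hL0).symm
      _ ≤ Real.exp (Real.sqrt (Real.log X₃ / 2)) := Real.exp_le_exp.mpr (h1.trans h2)
  have hW1 : 1 ≤ V ^ 5 := one_le_pow₀ hV1
  have hM' : 15 * Real.log V ≤ Sieve.nonpretentiousness (⇑μc) X₃ (V ^ 5) := by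
    have h1 := hM X₃ (hX₀.trans hXX₃) (V ^ 5) hW1 hV5'
    have h2 : Real.log (Real.log X) ≤ Real.log (Real.log X₃) :=
      Real.log_le_log (by linarith) hlogX₃
    rw [hμc] at *
    linarith
  have hk := hkey X₃ X₃ V L α μc hμmult hμ1 (hXs.trans hXX₃) le_rfl (by linarith) hV₀ hV5' hV1015
    hLX₃ hLexp hlogL hM'
  have hfloor : ⌊X₃⌋₊ = X + 2 * H := by rw [hX₃, Nat.floor_natCast]
  rw [hfloor] at hk
  set u : ℕ → ℂ := typFun (⇑μc) ((V ^ 5) ^ 200) ((L : ℝ) / (V ^ 5) ^ 3) (Real.sqrt X₃) X₃ with hu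
  have hu1 : ∀ n, ‖u n‖ ≤ 1 := fun n => norm_typFun_le hμ1 _ _ _ _ n
  have hwin : ∀ (s : Finset ℕ) (φ : ℕ → ℝ), ‖∑ m ∈ s, u m * (𝐞 (φ m) : ℂ)‖ ≤ #s := by
    intro s φ
    calc ‖∑ m ∈ s, u m * (𝐞 (φ m) : ℂ)‖ ≤ ∑ m ∈ s, ‖u m * (𝐞 (φ m) : ℂ)‖ :=
          norm_sum_le _ _
      _ ≤ ∑ m ∈ s, (1 : ℝ) := Finset.sum_le_sum fun m _ => by
          rw [norm_mul, Circle.norm_coe, mul_one]; exact hu1 m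
      _ = #s := by rw [Finset.sum_const, nsmul_eq_mul, mul_one]
  have hwinL : ∀ k, ‖∑ m ∈ Ioc (k - L) k, u m * (𝐞 ((m : ℝ) * α) : ℂ)‖ ≤ L := by
    intro k
    refine (hwin _ _).trans ?_
    rw [Nat.card_Ioc]
    exact_mod_cast (show k - (k - L) ≤ L by omega)
  have hsplit : Icc 1 (X + 2 * H) = Ico 1 L ∪ Ico L (X + L + 1) := by
    ext k; simp only [Finset.mem_Icc, Finset.mem_union, Finset.mem_Ico, hL]; omega
  have hdisj : Disjoint (Ico 1 L) (Ico L (X + L + 1)) := by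
    rw [Finset.disjoint_left]; intro k hk hk'
    rw [Finset.mem_Ico] at hk hk'; omega
  rw [hsplit, Finset.sum_union hdisj]
  have hV0 : 0 < V := by linarith
  have hsmall : ∑ k ∈ Ico 1 L, ‖∑ m ∈ Ioc (k - 2 * H) k, u m * (𝐞 ((m : ℝ) * α) : ℂ)‖ ^ 2 ≤
      (L : ℝ) ^ 2 * X₃ / V := by
    calc ∑ k ∈ Ico 1 L, ‖∑ m ∈ Ioc (k - 2 * H) k, u m * (𝐞 ((m : ℝ) * α) : ℂ)‖ ^ 2
        ≤ ∑ k ∈ Ico 1 L, (L : ℝ) ^ 2 := Finset.sum_le_sum fun k _ =>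
          pow_le_pow_left₀ (norm_nonneg _) (hwinL k) 2
      _ ≤ L * (L : ℝ) ^ 2 := by
          rw [Finset.sum_const, Nat.card_Ico, nsmul_eq_mul]
          gcongr
          exact_mod_cast Nat.sub_le L 1
      _ = (L : ℝ) ^ 2 * ((L : ℝ) * V) / V := by field_simp
      _ ≤ (L : ℝ) ^ 2 * X₃ / V := by
          have hLVle : (L : ℝ) * V ≤ X₃ := by
            calc (L : ℝ) * V ≤ (L : ℝ) * V ^ 75 :=
                  mul_le_mul_of_nonneg_left (le_self_pow₀ hV1 (by norm_num)) hL0.le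
              _ ≤ X₃ := hLX₃
          exact div_le_div_of_nonneg_right (mul_le_mul_of_nonneg_left hLVle (by positivity)) hV0.le
  have hbig : ∑ k ∈ Ico L (X + L + 1), ‖∑ m ∈ Ioc (k - 2 * H) k, u m * (𝐞 ((m : ℝ) * α) : ℂ)‖ ^ 2 ≤
      (L : ℝ) * (C * L * X₃ / V) := by
    rw [Finset.sum_Ico_eq_sum_range]
    have hrange : X + L + 1 - L = X + 1 := by omega
    rw [hrange]
    have hterm : ∀ x ∈ Finset.range (X + 1),
        ‖∑ m ∈ Ioc (L + x - 2 * H) (L + x), u m * (𝐞 ((m : ℝ) * α) : ℂ)‖ ^ 2 ≤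
          (L : ℝ) * ‖∑ n ∈ Ioc x (x + L), u n * (𝐞 (α * n) : ℂ)‖ := by
      intro x _
      have hw : Ioc (L + x - 2 * H) (L + x) = Ioc x (x + L) := by
        rw [hL]; congr 1 <;> omega
      have he : ∀ m : ℕ, (𝐞 ((m : ℝ) * α) : ℂ) = (𝐞 (α * m) : ℂ) := fun m => by rw [mul_comm]
      simp_rw [hw, he]
      rw [sq]
      refine mul_le_mul_of_nonneg_right ?_ (norm_nonneg _)
      refine (hwin (Ioc x (x + L)) (fun m => α * m)).trans ?_
      rw [Nat.card_Ioc]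
      exact_mod_cast (show x + L - x ≤ L by omega)
    refine (Finset.sum_le_sum hterm).trans ?_
    rw [← Finset.mul_sum]
    refine mul_le_mul_of_nonneg_left ?_ hL0.le
    refine le_trans ?_ hk
    refine Finset.sum_le_sum_of_subset_of_nonneg (fun x hx => ?_) (fun _ _ _ => norm_nonneg _)
    rw [Finset.mem_range] at hx ⊢; omega
  calc _ ≤ (L : ℝ) ^ 2 * X₃ / V + (L : ℝ) * (C * L * X₃ / V) := add_le_add hsmall hbig
    _ = (C + 1) * (L : ℝ) ^ 2 * X₃ / V := by field_simp; ring

/-! ### Theorem 1.2 (i) for `μ` and for `λ`, given Proposition 2.7 -/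

/-- `|λ(n)| ≤ 1` (as a real number; `λ(0) = 0`). [folklore] -/
theorem abs_liouville_real_le_one (n : ℕ) : |(ArithmeticFunction.liouville n : ℝ)| ≤ 1 := by
  have h := norm_liouville_complex_le_one n
  rw [ArithmeticFunction.intCoe_apply, Complex.norm_intCast] at h
  exact_mod_cast h

/-- **Theorem 1.2 (i) for the Möbius function, given the moment bound of Proposition 2.7** (in
the `𝖧₁`-form of `holder_fourier_bound`, hypothesis `hM`): the statement of
`lichtmanTeravainen2022_hlc_avg` with `hlcMoebiusSum` unfolded.
[cite: LichtmanTeravainen2022, Theorem 1.2 (i)] -/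
theorem hlc_avg_moebius_of_moments
    (hM : ∀ (A : Finset ℕ) (ε : ℝ), 0 < ε → (∀ a ∈ A, 1 ≤ a) →
      ∃ (j C₀ : ℕ) (B X₁ : ℝ), 2 ≤ j ∧ ∀ (X H : ℕ), X₁ ≤ (X : ℝ) →
        Real.log X ^ ((#A : ℝ) + ε) ≤ H → (H : ℝ) ≤ X → ∀ b : ℕ → ℂ, (∀ n, ‖b n‖ ≤ 1) →
        ∫ α in (0 : ℝ)..1, ∑ k ∈ Icc 1 (X + 2 * H),
          ‖∑ n ∈ Ioc (k - 2 * H) k,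
            (if n ∈ Icc 1 X then b n * ∏ a ∈ A, (Λ (n + a) : ℂ) else 0) *
              (𝐞 (-((n : ℝ) * α)) : ℂ)‖ ^ (2 * j) ≤
          B * Real.log (Real.log X) ^ C₀ * ((2 * H : ℕ) : ℝ) ^ (2 * j - 1) * ((X + 2 * H : ℕ) : ℝ)) :
    ∀ ε : ℝ, 0 < ε → ∀ A B' : Finset ℕ, A.Nonempty → Disjoint A B' → (∀ s ∈ A ∪ B', 1 ≤ s) →
    ∃ a : ℝ, 0 < a ∧ ∃ C X₀ : ℝ, ∀ X : ℕ, X₀ ≤ X → ∀ H : ℕ,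
      Real.log X ^ ((A.card : ℝ) + ε) ≤ H → (H : ℝ) ≤ Real.exp (Real.log X ^ a) →
        ∑ h₁ ∈ Icc 1 H, |∑ n ∈ Icc 1 X, (∏ a ∈ A, ArithmeticFunction.vonMangoldt (n + a)) *
          ∏ b ∈ insert h₁ B', (ArithmeticFunction.moebius (n + b) : ℝ)| ≤
          C * H * X * Real.log (Real.log H) / Real.log H :=
  hlc_avg_core (fun n => (ArithmeticFunction.moebius n : ℝ))
    (ArithmeticFunction.moebius : ArithmeticFunction ℂ)
    (fun n => by exact_mod_cast ArithmeticFunction.abs_moebius_le_one)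
    (fun n => by rw [ArithmeticFunction.intCoe_apply]; push_cast; rfl)
    moebius_typ_window_sq_le hM

/-- **Theorem 1.2 (i) for the Liouville function, given the moment bound of Proposition 2.7**:
the statement of `lichtmanTeravainen2022_hlc_avg_liouville` with `hlcLiouvilleSum` unfolded
("As is clear from the proof, Theorem 1.2 holds equally well with the Liouville function in place
of the Möbius function"). [cite: LichtmanTeravainen2022, Theorem 1.2 (i) and the remark following it] -/
theorem hlc_avg_liouville_of_moments
    (hM : ∀ (A : Finset ℕ) (ε : ℝ), 0 < ε → (∀ a ∈ A, 1 ≤ a) →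
      ∃ (j C₀ : ℕ) (B X₁ : ℝ), 2 ≤ j ∧ ∀ (X H : ℕ), X₁ ≤ (X : ℝ) →
        Real.log X ^ ((#A : ℝ) + ε) ≤ H → (H : ℝ) ≤ X → ∀ b : ℕ → ℂ, (∀ n, ‖b n‖ ≤ 1) →
        ∫ α in (0 : ℝ)..1, ∑ k ∈ Icc 1 (X + 2 * H),
          ‖∑ n ∈ Ioc (k - 2 * H) k,
            (if n ∈ Icc 1 X then b n * ∏ a ∈ A, (Λ (n + a) : ℂ) else 0) *
              (𝐞 (-((n : ℝ) * α)) : ℂ)‖ ^ (2 * j) ≤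
          B * Real.log (Real.log X) ^ C₀ * ((2 * H : ℕ) : ℝ) ^ (2 * j - 1) * ((X + 2 * H : ℕ) : ℝ)) :
    ∀ ε : ℝ, 0 < ε → ∀ A B' : Finset ℕ, A.Nonempty → Disjoint A B' → (∀ s ∈ A ∪ B', 1 ≤ s) →
    ∃ a : ℝ, 0 < a ∧ ∃ C X₀ : ℝ, ∀ X : ℕ, X₀ ≤ X → ∀ H : ℕ,
      Real.log X ^ ((A.card : ℝ) + ε) ≤ H → (H : ℝ) ≤ Real.exp (Real.log X ^ a) →
        ∑ h₁ ∈ Icc 1 H, |∑ n ∈ Icc 1 X, (∏ a ∈ A, ArithmeticFunction.vonMangoldt (n + a)) *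
          ∏ b ∈ insert h₁ B', (ArithmeticFunction.liouville (n + b) : ℝ)| ≤
          C * H * X * Real.log (Real.log H) / Real.log H :=
  hlc_avg_core (fun n => (ArithmeticFunction.liouville n : ℝ))
    (ArithmeticFunction.liouville : ArithmeticFunction ℂ)
    abs_liouville_real_le_one
    (fun n => by rw [ArithmeticFunction.intCoe_apply]; push_cast; rfl)
    liouville_typ_window_sq_le hM

end LichtmanTeravainen2022

end Literature.NumberTheory.Sieve
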